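import Summits.AnomalousDissipation.AnomalousDissipation.Theses.TwoAndHalfD
import Summits.AnomalousDissipation.AnomalousDissipation.Theorems.TwoAndHalfDTwohalfdThesisLine
import Summits.AnomalousDissipation.AnomalousDissipation.Theorems.TwoAndHalfDTwohalfdThesisStubWeakDuhamel
import Summits.AnomalousDissipation.AnomalousDissipation.Theorems.TwoAndHalfDTwohalfdThesisStubDuhamelVariance
import Summits.AnomalousDissipation.AnomalousDissipation.Theorems.TwoAndHalfDTwohalfdThesisStubDissipationFloor
import Summits.AnomalousDissipation.AnomalousDissipation.Theorems.TwoAndHalfDTwohalfdThesisStubLiftBudget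
import Summits.AnomalousDissipation.AnomalousDissipation.Theorems.TwoAndHalfDTwohalfdThesisStubStrainGate
import Summits.AnomalousDissipation.AnomalousDissipation.Theorems.TwoAndHalfDTwohalfdThesisStubWindowsToMean
import Summits.AnomalousDissipation.AnomalousDissipation.Theorems.TwoAndHalfDTwohalfdThesisStubShellEnstrophyBound
import Summits.AnomalousDissipation.AnomalousDissipation.Theorems.TwoAndHalfDTwohalfdThesisStrainGateEnstrophy
import Summits.AnomalousDissipation.AnomalousDissipation.Theorems.TwoAndHalfDTwohalfdThesisStubGKFloorOfTail
import Summits.AnomalousDissipation.AnomalousDissipation.Theorems.TwoAndHalfDTwohalfdThesisStubGKLimsupNecessary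
import Summits.AnomalousDissipation.AnomalousDissipation.Theorems.TwoAndHalfDTwohalfdThesisStubUnforcedNoGo
import Summits.AnomalousDissipation.AnomalousDissipation.Theorems.TwoAndHalfDTwohalfdThesisSubLogKillsW
import Summits.AnomalousDissipation.AnomalousDissipation.Theorems.TwoAndHalfDTwohalfdThesisWOfProfileMixer
import Summits.AnomalousDissipation.AnomalousDissipation.Theorems.TwoAndHalfDTwohalfdThesisSharedCore
import Summits.AnomalousDissipation.AnomalousDissipation.Theorems.TwoAndHalfDTwohalfdNegPlanarIdentification
import Summits.AnomalousDissipation.AnomalousDissipation.Theorems.TwohalfdThesis.Negative.TwohalfdThesisFalseOfSubLogStrain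
import Summits.AnomalousDissipation.AnomalousDissipation.Theorems.TwoAndHalfDScalarLiftGlueR
import Summits.AnomalousDissipation.AnomalousDissipation.Theorems.TwoAndHalfDScalarAnomalySteadySourceFormalColdStartVariance
import Summits.AnomalousDissipation.AnomalousDissipation.Theorems.TwoAndHalfDTwohalfdThesisSobolevCondensate
import Summits.AnomalousDissipation.AnomalousDissipation.Theorems.TwoAndHalfDTwohalfdThesisSobolevCondensateLipschitz
import Summits.AnomalousDissipation.AnomalousDissipation.Theorems.TwoAndHalfDTwohalfdThesisSobolevCondensateWitnessFar
import Summits.AnomalousDissipation.AnomalousDissipation.Theorems.TwoAndHalfDTwohalfdNegReductionOffZero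
import Summits.AnomalousDissipation.AnomalousDissipation.Theorems.TwoAndHalfDTwohalfdNegPerForceCertificate
import Summits.AnomalousDissipation.AnomalousDissipation.Theorems.TwoAndHalfDTwohalfdNegPlanarNoAnomaly
import Summits.AnomalousDissipation.AnomalousDissipation.Theorems.TwoAndHalfDTwohalfdThesisStubPlanarSubLogNoGo
import Summits.AnomalousDissipation.AnomalousDissipation.Theorems.TwoAndHalfDTwohalfdThesisStubEventualLogStrain
import Summits.AnomalousDissipation.AnomalousDissipation.Theorems.TwoAndHalfDTwohalfdThesisStubStrainSqLeEnstrophy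
import Summits.AnomalousDissipation.AnomalousDissipation.Theorems.TwoAndHalfDTwohalfdThesisStubPlanarEnstrophyCeiling
import Summits.AnomalousDissipation.AnomalousDissipation.Theorems.TwoAndHalfDTwohalfdThesisStubWitnessWindow
import Summits.AnomalousDissipation.AnomalousDissipation.Theorems.TwoAndHalfDTwohalfdThesisStubUniformLogStrain
import Summits.AnomalousDissipation.AnomalousDissipation.Theorems.TwoAndHalfDTwohalfdThesisStubUniformWindow
import Summits.AnomalousDissipation.AnomalousDissipation.Theorems.TwoAndHalfDTwohalfdThesisStubVorticityEquation
import Summits.AnomalousDissipation.AnomalousDissipation.Theorems.TwoAndHalfDTwohalfdThesisStubEnvelopedSourceVariance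
import Summits.AnomalousDissipation.AnomalousDissipation.Theorems.TwoAndHalfDTwohalfdThesisStubPlanarCurlTools
import Summits.AnomalousDissipation.AnomalousDissipation.Theorems.TwoAndHalfDTwohalfdThesisStubTwinEnstrophyCeiling
import Summits.AnomalousDissipation.AnomalousDissipation.Theorems.TwoAndHalfDTwohalfdThesisStubNonselectiveNoGo
import Summits.AnomalousDissipation.AnomalousDissipation.Theorems.TwoAndHalfDTwohalfdThesisStubTorqueColdStartDiverges
import Summits.AnomalousDissipation.AnomalousDissipation.Theorems.TwoAndHalfDTwohalfdThesisStubOcGate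
import Summits.AnomalousDissipation.AnomalousDissipation.Theorems.TwoAndHalfDTwohalfdThesisStubDissipationFloorLimsup
import Summits.AnomalousDissipation.AnomalousDissipation.Theorems.TwoAndHalfDTwohalfdThesisStubNoQuietWindow
import Summits.AnomalousDissipation.AnomalousDissipation.Theorems.TwoAndHalfDTwohalfdThesisStubLimsupKernelTransfer
import Summits.AnomalousDissipation.AnomalousDissipation.Theorems.TwoAndHalfDTwohalfdThesisStubOcGateQuantitative
import Summits.AnomalousDissipation.AnomalousDissipation.Theorems.TwoAndHalfDTwohalfdThesisStubMeanEnergyFloorOfLoss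
import Literature.Analysis.FluidPDE.TwoHalfSection
import Literature.Analysis.FluidPDE.LerayHopfGalileanTorusMeans
import Literature.Barriers.AnomalousDissipation.TwoDimensionalEnergyDissipationL2Data
import Literature.Analysis.FluidPDE.TwoHalfNavierStokes
import Literature.Analysis.FluidPDE.TwoHalfWeakEuler
import Literature.Analysis.FluidPDE.TorusClassicalLerayHopfProofs
import Literature.Analysis.FluidPDE.ScalarTransportDuality
import Literature.Analysis.FluidPDE.PassiveScalarEnergySlice
import Literature.Analysis.FluidPDE.LongTimeAverageSubadditive
import Literature.Barriers.AnomalousDissipation.GravestModeLaminarAttractorSwept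
import Literature.Barriers.AnomalousDissipation.ObukhovCorrsinThresholdProofs

/-!
# Line `duhamel-release` (slug `Sketch`) for the crux `TwoAndHalfD.TwohalfdThesis`
# (stmt-AnomalousDissipation-0206) — LEAD'S skeleton v23 (lead c10, 2026-08-17: v20 with Q6 `stub_torqueColdStartDiverges` WIRED to the
# landed theorem p147103, + section R — R1 `stub_ocGate` p165328, R2 `stub_dissipationFloorLimsup` p165651, R3 `stub_limsupKernelTransfer`
# p166491 (+ W ⇒ W′ p166941), R4 `stub_noQuietWindow` p166426, R5 `stub_ocGateQuantitative` p168786, R6 `stub_meanEnergyFloorOfLoss` p169071 —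
# ALL LANDED and wired (v23); the ONLY `sorry` is again W `stub_releasedMixingWitness`; v20 (lead c9) = v18 with P-CERT `stub_uniformWindow` WIRED to the landed
# theorem p141701, + section Q, SELECTIVITY OF THE WITNESS'S MIXING — registered tool stubs, ALL LANDED and wired below (Q1 p143927, Q2 p144767, Q3 p145693, Q4 p146323, Q5 p146373, Q6 p147103): Q1 `stub_vorticityEquation` (classical planar
# vorticity equation = the Pr-1 twin), Q2 `stub_envelopedSourceVariance` (Duhamel with datum: enveloped releases of a steady source cap the
# limsup-mean variance by `M²‖source‖²`), Q3 `stub_planarCurlTools` (`∫curl = 0`, `‖∇v‖₂² = ‖curl v‖₂²`), Q4 `stub_twinEnstrophyCeiling`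
# (uniform envelope for the releases of `curl g` ⇒ mean enstrophy `≤ M²‖curl g‖²`), Q5 `stub_nonselectiveNoGo` (W's body + a uniform integrable
# envelope for the torque pattern `curl g` is contradictory: G5's `log²` floor vs Q4's ceiling); + Q6 `stub_torqueColdStartDiverges` (the Pr = 1
# SPLITTING: over the same witness flow the `h`-cold start saturates while the torque cold start's mean variance is `≥ (a log(1/ν_j) − b)²`; LANDED p147103);
# the crux-directed `sorry` is still only W;
# v18 (lead c8) = v16 + section O, THE WITNESS WINDOW, + section P, UNIFORMITY —
# P1 `stub_uniformLogStrain` (the floor constant depends only on `(f, E, ε)`, p141462), P-CERT `stub_uniformWindow` p141701 (window with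
# uniform constants `c(f,E,ε)`, `C(f,E)`) — ALL LANDED and wired below;
# tool stubs O1 `stub_planarSubLogNoGo` p140640, O2 `stub_eventualLogStrain` p140779, O3 `stub_strainSqLeEnstrophy` p140781,
# O4 `stub_planarEnstrophyCeiling` p140763, O-CERT `stub_witnessWindow` p141528 — ALL LANDED and wired below to the tree theorems;
# the only `sorry` is again W `stub_releasedMixingWitness`; v16 = v15 with SC-LIP/SC-FAR wired to the landed
# tree theorems p139147/p138902 — the only OPEN stub is W `stub_releasedMixingWitness`; v15 (lead c7) = v13 + section N, the SOBOLEV-CONDENSATE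
# no-go for X-witnesses — tool stubs SC-RL/SC-CMP/SC-WL2/SC-LIM/SC-CON/SC-CERT over the landed κ = 0 Sobolev
# DiPerna–Lions balance p136128, ALL LANDED (p136891 p137431 p137852 p137793 p136503, assembly p138190, corollaries
# SC-LIP p139147 / SC-FAR p138902); section N is wired below to the tree theorems (v15a: SC-LIP/SC-FAR, landed, are
# still `sorry`-stubs here until the farm has built their modules — v15b wires them); the only OPEN stub is W; v13 (lead c6) = v12 + section M, the NEGATIVE LEMMA
# `SubLogStrain → ¬X` landed on this item with `--negative-modulo` (p135209) and the disprover's three §4 near-misses as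
# unconditional theorems; v12 (lead c4) = v11 + section L, the SIBLING IDENTIFICATION
# `X ↔ crux #2 (0448)`, `¬X ↔ crux #5 (0211)` as unconditional tree theorems — the crux is decided by its siblings; v11 (lead c3)
# = v10 + J2 `stub_releasedMixingWitness_of_profileMixerRealizable` (0448's kernel S1' ⇒ W, LANDED p132866); history: v7 (lead c3; reshaped from `Cruxes/TwohalfdThesis/SketchIdeator2.lean`;
# v2 = v1 with D0, D1, D2, T1, T2 LANDED — only W is open; v3 = v2 + the STRAIN GATE tool stubs G1–G4 (lead c2);
# v4–v6 (leads gen-1/c2) = G1-W, G4, G5 LANDED; v7 (lead c3) = tree v3 with G1-W/G4/G5 wired to the landed theorems —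
# v10 (lead c3) = v7 + tool stubs H1-tools/H1 (GK floor automatic for fast mixers: envelope tail ⇒ W's Green–Kubo clause),
# H2 (GK clause necessary in limsup form), H3 (no-go: unforced planar flow), J1 (junction: 0211's S6 ⇒ ¬W) — ALL LANDED
# (p116589 p118430 p117026 p118146 p118382); the ONLY `sorry` is again W `stub_releasedMixingWitness`)

Crux (fixed, by name): `TwohalfdThesis` = the zeroth law inside the `x₃`-invariant (2½-D) class — ONE steady smooth
solenoidal mean-zero `x₃`-invariant force on `T³`, `ν_j → 0`, `x₃`-invariant global Leray–Hopf solutions with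
`ν`-uniformly bounded limsup-mean energy and limsup-mean dissipation `≥ ε > 0`.

THE LINE (idea card `Cruxes/TwohalfdThesis/Ideas/duhamel-release-dissipation-time.md`, checked sketch
`SketchIdeator2.lean`, triage r1-1/r1-2: pass).  DUHAMEL RELEASE: the steadily SOURCED third component `w_j` of a 2½-D
witness is the superposition `w_j(t) = ∫₀ᵗ φ_{j,s}(t) ds` of the UNFORCED unit-Prandtl scalars `φ_{j,s}` released with
datum `h` at every time `s` over the planar Navier–Stokes flow `v_j`; the two scalar clauses of the crux (ν-uniformly
bounded variance, dissipation floor) follow from (i) ONE integrable `L²`-envelope `‖φ_{j,s}(t)‖ ≤ Λ(t-s)‖h‖` uniform in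
the release time and in `j` (a ν-UNIFORM DISSIPATION TIME for the single datum `h`) and (ii) a Green–Kubo / no-echo floor
on the source–response correlation `∫₀ᵗ (h, φ_{j,s}(t)) ds`.

RESHAPE BY THE LEAD (v1, 2026-08-16; reasons in `PICKED.md` / NOTES): the sketch's chain
`DuhamelTransfer → DuhamelMixingWitness → SourcedScalarUnique2D → ScalarLift2halfD → ScalarLiftGlue → X` went through
the WEAK (Leray–Hopf / distributional) glue items 14323–14325 of the route; `ScalarLift2halfD` (14324) is FALSE as typed
(non-measurable-datum loophole, `Theorems/TwoAndHalfDScalarLift2halfDRefutationTools.lean`, refutation in flight) and the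
weak Duhamel superposition / weak uniqueness are XL with no payoff for `X`.  In the 2½-D class at fixed `ν > 0` every
object is CLASSICAL (2-D NS from smooth data is smooth; the sourced scalar is the tree's unique classical solution), and
classical 2½-D fields ARE global Leray–Hopf solutions in the tree
(`Torus.isClassicalNSSolutionOn_twoHalf` + `IsClassicalNSSolutionOn.isLerayHopfOn_of_convex`).  So the line is re-typed
at the classical level, where every transfer stub is an honest calculus / duality lemma over ONE smooth divergence-free
drift, and the crux is reached BY NAME without items 14323–14325:

* W  `stub_releasedMixingWitness` — TRANSFER TARGET `C⁺` (the residual crux; XL, OPEN; held by the lead): a steadily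
     forced classical 2-D NS family with pointwise bounded energy whose released `h`-patterns obey one integrable
     envelope (uniform in `j` and in the release time `s ≥ s₀`) and a Green–Kubo floor.
* D0 `stub_weakDuhamel`      — WEAK DUHAMEL BY DUALITY (M): for the classical cold start `θ` (source `h`, zero datum)
     and the classical releases `φ_s` of `h`, `∫ θ(t)χ = ∫₀ᵗ (∫ φ_s(t)χ) ds` for every smooth `χ`, `t ≥ 0` — by the
     forward–backward duality of the tree (`IsClassicalScalarTransportOn.integral_mul_eq_of_reverse`, plus its
     one-term forced twin), with NO joint regularity of the two-parameter propagator.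
* D1 `stub_duhamelVariance`  — envelope + weak Duhamel ⇒ `‖θ(t)‖² ≤ (s₀ + M)²‖h‖²` (M; Minkowski under the integral,
     `‖φ_s(t)‖ ≤ ‖h‖` for the early releases `s < s₀` by `antitoneOn_scalarL2Sq`).
* D2 `stub_dissipationFloor` — liminf-mean input-power floor + bounded variance ⇒ `ε ≤ ⟨κ‖∇θ‖²⟩` (M; sourced `L²`
     balance in Cesàro form; the liminf-mean twin of the sibling line's S4 on crux #2).
* T2 `stub_liftBudget`       — budgets of the classical 2½-D lift (M): `meanEnergy ((v,θ)∘π) ≤ E + B` and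
     `⟨ν‖∇θ‖²⟩ ≤ meanDissipation ν ((v,θ)∘π)` (`integral_norm_sq_twoHalf`, `toReal_eGradNormSq_twoHalf`,
     `longTimeAvgSup_mono`; Cesàro-boundedness of the lift's dissipation from `IsClassicalNSSolutionOn.energy_eq`).
The classical lift itself (T1, `lift_isClassicalNSSolutionOn`) is PROVED below, and `TwohalfdThesis_of_stubs` composes
W, D0, D1, D2, T2 into the crux BY NAME (kernel-checked; cold starts from the landed
`ColdStartVariance.exists_global_coldStart`).  The same composition with the five statements as hypotheses lives in
the tree Line file `Theorems/TwoAndHalfDTwohalfdThesisLine.lean` (`…Theorems.TwohalfdThesis.TwohalfdThesis_of`).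

Disproof.lean honoured (`Cruxes/TwohalfdThesis/Disproof.lean` v2, read 2026-08-16): §2 load-bearing constraints — W keeps
ONE fixed `(g,h)`, `ν_j → 0`, a pointwise (hence honest) energy ceiling and mean-zero `g,h`; §3 `not_twohalfdThesis
BoundedEnstrophy` — W bounds ENERGY pointwise, never enstrophy (the envelope forces `‖∇v_j‖_∞ ≳ log(1/ν_j)`, allowed);
§5 (a witness must SOURCE its third component) — the third component is the `h`-sourced cold start, `ε ≤ ⟨(h,θ_j)⟩`;
§1 kill shape `¬X ↔ TwohalfdNeg` — untouched (W is an `∃`).  Relation to the sibling crux #2's picked line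
`budgeted-mixer-template` (stmt-0448): same classical level and the same open core (ν-uniform mixing of ONE datum by a
steadily forced bounded-energy planar flow), different sufficient spec (integrable envelope + GK floor here, sector
halving + finite-lag cold-start floor there); D2/T2 and the lift serve both.
-/

noncomputable section

set_option linter.dupNamespace false

namespace Summit.AnomalousDissipation.AnomalousDissipation.Cruxes.TwohalfdThesis.DuhamelRelease

open MeasureTheory Set Filter Topology
open scoped ENNReal NNReal InnerProductSpace
open Literature.Analysis.FunctionSpaces Literature.Analysis.FluidPDE
open Summit.AnomalousDissipation.AnomalousDissipation.Theses.TwoAndHalfD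

/-! ## W — the transfer target `C⁺`: a released-family mixing witness (the residual crux) -/

/-- **W `stub_releasedMixingWitness` — TRANSFER TARGET `C⁺` (XL, OPEN; the lead's stub).**  There are a smooth
divergence-free mean-zero steady planar force `g`, a smooth mean-zero pattern `h`, viscosities `ν_j → 0`, CLASSICAL
solutions `(v_j, p_j)` of the 2-D Navier–Stokes system forced by `g` on `[0, ∞) × T²` (data free: e.g. on an invariant
set), the classical RELEASED FAMILIES `φ_j s` (the unforced unit-Prandtl scalar over `v_j` on `[s, ∞)` released with
datum `h` at time `s`; it exists and is unique, the witness merely names it), an envelope `Λ ≥ 0` with `∫₀^∞ Λ ≤ M`, a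
spin-up time `s₀ ≥ 0`, an energy level `E` and a floor `ε > 0` such that for every `j`:
* (energy)   `∫‖v_j(t)‖² ≤ E` for all `t ≥ 0` (pointwise, hence honest);
* (envelope) `‖φ_j s (t)‖²_{L²} ≤ Λ(t-s)² ‖h‖²_{L²}` for all `s₀ ≤ s ≤ t` — ONE dissipation time for the ONE datum `h`,
             uniform in the release time and in `j` (selective: nothing is asked of other data, cf. the vorticity twin);
* (GK floor) `ε ≤ liminf_T T⁻¹∫₀ᵀ (∫₀ᵗ (h, φ_j s(t)) ds) dt` — the released pattern does not come back anti-correlated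
             with `h` on average (no reactive echo).
Why it might fail: W10–W12 of the ideator's negative notes (log law `‖∇v_j‖ ≳ log(1/ν_j)` is necessary — allowed by the
budgets but must be realised by steadily forced bounded-energy 2-D dynamics on some invariant set; condensation to a
near-autonomous state gives `κ^{1/3}` relaxation only).  `¬W` for all `(g,h)` is a uniform mixing-rate ceiling feeding
`TwohalfdNeg`.  NECESSARY CONDITION IN TREE (log gate, p91755 `Theorems/TwoAndHalfDTwohalfdThesisStubLogGate.lean`,
`releaseEnvelope_false_of_gradient_bound`): a `j`-uniform loss `‖φ_j(s+τ₀)‖² ≤ (1-δ)‖h‖²` is impossible along `ν_j → 0` if the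
drifts have `j`-uniformly bounded first derivatives on `[s, s+τ₀]` — witnesses must have `‖∇v_j‖_∞ → ∞` (quantitatively
`≳ log(1/ν_j)/τ₀`).  Leans on: nothing in tree decides W (BrueDeLellis2023 Q2.1–2.2; arXiv:2304.05374; arXiv:1911.11014). -/
theorem stub_releasedMixingWitness :
    ∃ (g : (UnitAddTorus (Fin 2)) → (EuclideanSpace ℝ (Fin 2))) (h : (UnitAddTorus (Fin 2)) → ℝ),
      Torus.IsSmooth g ∧ Torus.IsDivFree g ∧ Torus.HasZeroMean g ∧ Torus.IsSmooth h ∧ Torus.HasZeroMean h ∧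
      ∃ (ν : ℕ → ℝ) (v : ℕ → ℝ → (UnitAddTorus (Fin 2)) → (EuclideanSpace ℝ (Fin 2))) (p : ℕ → ℝ → (UnitAddTorus (Fin 2)) → ℝ) (φ : ℕ → ℝ → ℝ → (UnitAddTorus (Fin 2)) → ℝ)
        (Λ : ℝ → ℝ) (E s₀ M ε : ℝ),
        (∀ j, 0 < ν j) ∧ Tendsto ν atTop (𝓝 0) ∧
        (∀ j, Torus.IsClassicalNSSolutionOn (Ici 0) (ν j) (fun _ => g) (v j) (p j)) ∧
        (∀ j t, 0 ≤ t → ∫ x, ‖v j t x‖ ^ 2 ≤ E) ∧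
        (∀ j s, 0 ≤ s → Torus.IsClassicalScalarTransportOn (Ici s) (ν j) (v j) (φ j s) ∧ φ j s s = h) ∧
        0 ≤ s₀ ∧ (∀ τ, 0 ≤ Λ τ) ∧ IntegrableOn Λ (Ici 0) ∧ (∫ τ in Ici 0, Λ τ) ≤ M ∧
        (∀ j s t, s₀ ≤ s → s ≤ t → Torus.scalarL2Sq (φ j s t) ≤ Λ (t - s) ^ 2 * Torus.scalarL2Sq h) ∧
        0 < ε ∧
        (∀ j, ε ≤ liminf (timeMean fun t => ∫ s in (0 : ℝ)..t, ∫ x, h x * φ j s t x) atTop) := by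
  sorry

/-! ## D0 — weak Duhamel by duality -/

/-- **D0 `stub_weakDuhamel` (M) — LANDED p87403 (`Theorems/TwoAndHalfDTwohalfdThesisStubWeakDuhamel.lean`).**  Let `κ > 0`, `θ` the classical solution of `∂ₜθ + u·∇θ = κΔθ + h` on `[0, ∞) × T²`
with `θ(0) = 0` (its drift `u` is jointly smooth and divergence free on `[0, ∞)` by the structure), and for every `s ≥ 0`
let `φ s` be a classical solution of the UNFORCED equation on `[s, ∞)` with `φ s s = h`.  Then for every smooth `χ` and
every `t ≥ 0`, `∫ θ(t) χ = ∫₀ᵗ (∫ φ s (t) χ) ds`.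
PROOF ROUTE (duality; no differentiation under the `ds`-integral): fix `t > 0` (at `t = 0` both sides vanish); solve the
REVERSED problem `∂_σ χ̃ + (−u(t−σ))·∇χ̃ = κΔχ̃`, `χ̃(0) = χ` on `[0, t]` by the tree's existence theorem
(`Torus.exists_isClassicalScalarTransportForcedOn`, source `0`; reversed drift smooth and divergence free:
`isSmoothSpaceTimeOn_reverse_neg`, `isDivFree_reverse`).  FORCED duality (one-term twin of
`IsClassicalScalarTransportOn.integral_mul_eq_of_reverse`: the pairing `σ ↦ ∫ θ(σ) χ̃(t−σ)` has derivative
`∫ h χ̃(t−σ)`): `∫ θ(t) χ = ∫ θ(0) χ̃(t) + ∫₀ᵗ ∫ h χ̃(t−s) ds = ∫₀ᵗ ∫ h χ̃(t−s) ds`.  UNFORCED duality for the release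
on `[s, t]` (shift to `[0, t−s]`, `IsSmoothSpaceTimeOn.shift` / `isSmoothSpaceTimeOn_comp_affine`):
`∫ φ s (t) χ = ∫ φ s (s) χ̃(t−s) = ∫ h χ̃(t−s)`.  Compare.  Leans on: `ScalarTransportDuality`,
`PassiveScalarWellPosednessProofs`, `PassiveScalarClassicalEnergy` (`restrict`); nothing unproved. -/
theorem stub_weakDuhamel :
    ∀ (κ : ℝ) (u : ℝ → (UnitAddTorus (Fin 2)) → (EuclideanSpace ℝ (Fin 2))) (h : (UnitAddTorus (Fin 2)) → ℝ) (θ : ℝ → (UnitAddTorus (Fin 2)) → ℝ) (φ : ℝ → ℝ → (UnitAddTorus (Fin 2)) → ℝ),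
      0 < κ → Torus.IsSmooth h →
      Torus.IsClassicalScalarTransportForcedOn (Ici 0) κ u (fun _ => h) θ → θ 0 = (fun _ => (0 : ℝ)) →
      (∀ s, 0 ≤ s → Torus.IsClassicalScalarTransportOn (Ici s) κ u (φ s) ∧ φ s s = h) →
      ∀ χ : (UnitAddTorus (Fin 2)) → ℝ, Torus.IsSmooth χ → ∀ t, 0 ≤ t →
        ∫ x, θ t x * χ x = ∫ s in (0 : ℝ)..t, ∫ x, φ s t x * χ x :=
  Summit.AnomalousDissipation.AnomalousDissipation.Theorems.TwohalfdThesis.stub_weakDuhamel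

/-! ## D1 — variance from the envelope (Minkowski under the Duhamel integral) -/

/-- **D1 `stub_duhamelVariance` (M) — LANDED p88959 (`Theorems/TwoAndHalfDTwohalfdThesisStubDuhamelVariance.lean`).**  With `θ`, `φ` as in D0 (`κ ≥ 0` suffices here), ASSUME the weak Duhamel
identity (conclusion of D0, fed in by the composition), an envelope `Λ ≥ 0`, integrable on `[0, ∞)` with `∫₀^∞ Λ ≤ M`,
and `‖φ s (t)‖² ≤ Λ(t−s)²‖h‖²` for `s₀ ≤ s ≤ t` (`s₀ ≥ 0` a spin-up time).  Then `‖θ(t)‖²_{L²} ≤ (s₀ + M)² ‖h‖²_{L²}` for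
all `t ≥ 0`.
PROOF ROUTE: take `χ := θ t` (smooth slice) in the identity: `‖θ(t)‖² = ∫₀ᵗ (∫ φ s (t) θ(t)) ds`; Cauchy–Schwarz
(`ColdStartVariance.integral_mul_le_sqrt_mul_sqrt`, landed) and the bounds `‖φ s (t)‖ ≤ ‖h‖` for `0 ≤ s ≤ t`
(`IsClassicalScalarTransportOn.antitoneOn_scalarL2Sq`, `κ ≥ 0`) and `‖φ s (t)‖ ≤ Λ(t−s)‖h‖` for `s ≥ s₀` give the
integrable majorant `b(s) = ‖h‖‖θ(t)‖(𝟙_{s < s₀} + Λ(t−s))`; `MeasureTheory.norm_integral_le_of_norm_le` (needs NO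
measurability of the integrand) gives `‖θ(t)‖² ≤ ‖h‖‖θ(t)‖(s₀ + M)`; divide (the case `‖θ(t)‖ = 0` is trivial).
Leans on: Mathlib interval integrals; `PassiveScalarClassicalEnergy`; nothing unproved. -/
theorem stub_duhamelVariance :
    ∀ (κ s₀ M : ℝ) (u : ℝ → (UnitAddTorus (Fin 2)) → (EuclideanSpace ℝ (Fin 2))) (h : (UnitAddTorus (Fin 2)) → ℝ) (θ : ℝ → (UnitAddTorus (Fin 2)) → ℝ) (φ : ℝ → ℝ → (UnitAddTorus (Fin 2)) → ℝ) (Λ : ℝ → ℝ),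
      0 ≤ κ → Torus.IsSmooth h →
      Torus.IsClassicalScalarTransportForcedOn (Ici 0) κ u (fun _ => h) θ →
      (∀ s, 0 ≤ s → Torus.IsClassicalScalarTransportOn (Ici s) κ u (φ s) ∧ φ s s = h) →
      (∀ χ : (UnitAddTorus (Fin 2)) → ℝ, Torus.IsSmooth χ → ∀ t, 0 ≤ t →
          ∫ x, θ t x * χ x = ∫ s in (0 : ℝ)..t, ∫ x, φ s t x * χ x) →
      0 ≤ s₀ → (∀ τ, 0 ≤ Λ τ) → IntegrableOn Λ (Ici 0) → (∫ τ in Ici 0, Λ τ) ≤ M →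
      (∀ s t, s₀ ≤ s → s ≤ t → Torus.scalarL2Sq (φ s t) ≤ Λ (t - s) ^ 2 * Torus.scalarL2Sq h) →
      ∀ t, 0 ≤ t → Torus.scalarL2Sq (θ t) ≤ (s₀ + M) ^ 2 * Torus.scalarL2Sq h :=
  Summit.AnomalousDissipation.AnomalousDissipation.Theorems.TwohalfdThesis.stub_duhamelVariance

/-! ## D2 — dissipation floor from the liminf-mean input power -/

/-- **D2 `stub_dissipationFloor` (M) — LANDED p89988 (`Theorems/TwoAndHalfDTwohalfdThesisStubDissipationFloor.lean`).**  For a classical solution `θ` of `∂ₜθ + u·∇θ = κΔθ + h` on `[0, ∞) × T²`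
(`κ ≥ 0`) with `‖θ(t)‖²_{L²} ≤ B` for `t ≥ 0` and a liminf-mean input-power floor
`ε ≤ liminf_T T⁻¹∫₀ᵀ (h, θ(t)) dt`, the limsup-mean dissipation (the crux's spectral `Torus.eScalarGradNormSq`, `toReal`)
is `≥ ε`.  (For `ε ≤ 0` this is the trivial `longTimeAvgSup_nonneg`.)
PROOF ROUTE: the sourced `L²` balance within `Ici 0`, `d/dt ‖θ(t)‖² = −2κ‖∇θ(t)‖² + 2∫ h θ(t)`
(`ColdStartVariance.forced_hasDerivWithinAt_scalarL2Sq`, landed toolkit), FTC on `[0, T]`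
(`continuousOn_scalarGradNormSq` for interval integrability):
`T⁻¹∫₀ᵀ κ‖∇θ‖² = T⁻¹∫₀ᵀ (h, θ) − (‖θ(T)‖² − ‖θ(0)‖²)/(2T) ≥ T⁻¹∫₀ᵀ (h,θ) − B/(2T)`; the power means are bounded
(`|(h, θ(t))| ≤ ‖h‖√B`), so `Filter.eventually_lt_of_lt_liminf` gives `T⁻¹∫₀ᵀ(h,θ) ≥ ε − δ` eventually, hence
`liminf ≥ ε` for the dissipation means and `limsup ≥ liminf` (bounded: dissipation mean `≤ ‖h‖√B + B/(2T)`);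
spectral = classical gradient norm on smooth slices (`scalarGradNormSq_eq_toReal_holds`).  Leans on:
`PassiveScalarClassicalEnergy`, `PassiveScalarEnergySlice`, `TurbWave0` (`timeMean`, `longTimeAvgSup`); nothing
unproved. -/
theorem stub_dissipationFloor :
    ∀ (κ B ε : ℝ) (u : ℝ → (UnitAddTorus (Fin 2)) → (EuclideanSpace ℝ (Fin 2))) (h : (UnitAddTorus (Fin 2)) → ℝ) (θ : ℝ → (UnitAddTorus (Fin 2)) → ℝ),
      0 ≤ κ → Torus.IsSmooth h →
      Torus.IsClassicalScalarTransportForcedOn (Ici 0) κ u (fun _ => h) θ →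
      (∀ t, 0 ≤ t → Torus.scalarL2Sq (θ t) ≤ B) →
      ε ≤ liminf (timeMean fun t => ∫ x, h x * θ t x) atTop →
      ε ≤ longTimeAvgSup (fun t => κ * (Torus.eScalarGradNormSq (θ t)).toReal) :=
  Summit.AnomalousDissipation.AnomalousDissipation.Theorems.TwohalfdThesis.stub_dissipationFloor

/-! ## T1 — the classical 2½-D lift (LANDED) -/

/-- **T1 — LANDED p86256 (`Theorems/TwoAndHalfDTwohalfdThesisLine.lean`, with the composition `TwohalfdThesis_of`).** If `(v, p)` is a classical solution of the planar Navier–Stokes system forced by the steady `g` on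
`[0, ∞) × T²` and `θ` a classical solution of `∂ₜθ + v·∇θ = νΔθ + h` (same `ν`: Prandtl number one) on `[0, ∞)`, then
`u(t) := (v(t), θ(t))∘π`, `P(t) := p(t)∘π` is a classical solution of the 3-D Navier–Stokes system on `[0, ∞) × T³`
forced by the steady 2½-D field `(g, h)∘π` (`Torus.isClassicalNSSolutionOn_twoHalf`, whose residual force
`twoHalfForce` is identified with `(g,h)∘π` through the two equations). [folklore] -/
theorem lift_isClassicalNSSolutionOn :
    ∀ (ν : ℝ) (g : UnitAddTorus (Fin 2) → EuclideanSpace ℝ (Fin 2)) (h : UnitAddTorus (Fin 2) → ℝ)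
      (v : ℝ → UnitAddTorus (Fin 2) → EuclideanSpace ℝ (Fin 2)) (p : ℝ → UnitAddTorus (Fin 2) → ℝ)
      (θ : ℝ → UnitAddTorus (Fin 2) → ℝ),
      Torus.IsClassicalNSSolutionOn (Ici 0) ν (fun _ => g) v p →
      Torus.IsClassicalScalarTransportForcedOn (Ici 0) ν v (fun _ => h) θ →
      Torus.IsClassicalNSSolutionOn (Ici 0) ν (fun _ => Torus.twoHalf g h)
        (fun t => Torus.twoHalf (v t) (θ t)) (fun t => p t ∘ Torus.planarProj) :=
  Summit.AnomalousDissipation.AnomalousDissipation.Theorems.TwohalfdThesis.lift_isClassicalNSSolutionOn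

/-! ## T2 — budgets of the lift -/

/-- **T2 `stub_liftBudget` (M) — LANDED p90523 (`Theorems/TwoAndHalfDTwohalfdThesisStubLiftBudget.lean`).**  For the classical 2½-D pair of T1 with POINTWISE bounds `∫‖v(t)‖² ≤ E` and
`‖θ(t)‖² ≤ B` (`t ≥ 0`), the lift `u(t) = (v(t), θ(t))∘π` has `meanEnergy u ≤ E + B` and its limsup-mean dissipation
dominates the scalar's: `⟨ν‖∇θ‖²⟩ ≤ meanDissipation ν u` (spectral norms, `toReal`).
PROOF ROUTE: energy — `∫‖u(t)‖² = ∫‖v(t)‖² + ‖θ(t)‖²` (`integral_norm_sq_twoHalf`, continuous slices) and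
`longTimeAvgSup_le_of_forall_le` (only `t > 0` matters); dissipation — for `t ≥ 0` the slices are smooth, so
`ν (eGradNormSq u(t)).toReal = ν (gradNormSq v(t) + scalarGradNormSq θ(t)) ≥ ν (eScalarGradNormSq θ(t)).toReal`
(`toReal_eGradNormSq_twoHalf`, `scalarGradNormSq_eq_toReal_holds`), then `longTimeAvgSup_mono`, whose side conditions
are: local integrability of `t ↦ ν (eGradNormSq u(t)).toReal` on `(0, T]` (continuity: `continuousOn_gradNormSq`,
`continuousOn_scalarGradNormSq`) and `IsBoundedUnder (· ≤ ·) atTop (timeMean …)` — the one delicate step: by the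
classical energy EQUALITY of the lift (`lift_isClassicalNSSolutionOn` + `IsClassicalNSSolutionOn.energy_eq` on `[0,T]`,
force `F = (g,h)∘π ∈ L²`), `ν∫₀ᵀ gradNormSq u = ½‖u(0)‖² − ½‖u(T)‖² + ∫₀ᵀ (F, u) ≤ ½(E+B) + T‖F‖₂√(E+B)`, so the
Cesàro means are `≤ (E+B)/(2T) + ‖F‖₂√(E+B)`, bounded for `T ≥ 1` (and `gradNormSq u(t) = (eGradNormSq u(t)).toReal`
on smooth slices, `gradNormSq_eq_toReal_eGradNormSq_holds`).  Leans on: `TwoHalfNavierStokes`,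
`TorusClassicalLerayHopfProofs`, `LongTimeAverageSubadditive`, `GravestModeLaminarAttractorSwept`
(`longTimeAvgSup_le_of_forall_le`); nothing unproved. -/
theorem stub_liftBudget :
    ∀ (ν E B : ℝ) (g : (UnitAddTorus (Fin 2)) → (EuclideanSpace ℝ (Fin 2))) (h : (UnitAddTorus (Fin 2)) → ℝ) (v : ℝ → (UnitAddTorus (Fin 2)) → (EuclideanSpace ℝ (Fin 2))) (p : ℝ → (UnitAddTorus (Fin 2)) → ℝ) (θ : ℝ → (UnitAddTorus (Fin 2)) → ℝ),
      0 < ν → Torus.IsSmooth g → Torus.IsSmooth h →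
      Torus.IsClassicalNSSolutionOn (Ici 0) ν (fun _ => g) v p →
      Torus.IsClassicalScalarTransportForcedOn (Ici 0) ν v (fun _ => h) θ →
      (∀ t, 0 ≤ t → ∫ x, ‖v t x‖ ^ 2 ≤ E) → (∀ t, 0 ≤ t → Torus.scalarL2Sq (θ t) ≤ B) →
      meanEnergy (fun t => Torus.twoHalf (v t) (θ t)) ≤ E + B ∧
        longTimeAvgSup (fun t => ν * (Torus.eScalarGradNormSq (θ t)).toReal) ≤
          meanDissipation ν (fun t => Torus.twoHalf (v t) (θ t)) :=
  Summit.AnomalousDissipation.AnomalousDissipation.Theorems.TwohalfdThesis.stub_liftBudget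

/-! ## G — the STRAIN GATE (lead c2, 2026-08-16): necessary structure of a W-witness in Navier–Stokes currency

Registered tool stubs (this cycle's wave).  Mechanism: the tree PROVES the Crippa–De Lellis / Seis logarithmic
dissipation bound for releases at Sobolev level (`Literature.Analysis.FluidPDE.Torus.releaseLogBound_smooth`:
`κ∫₀ᵀ‖∇θ‖² ≤ C(S+1)/log(1/κ)` for a smooth divergence-free drift with window strain `∫₀ᵀ‖∇u‖_{L²} ≤ S`), so
the loss of a fixed fraction of `‖h‖²` on a window of length `τ₀` (W's envelope at ONE lag) costs window strain
`≥ c·log(1/κ) − 1`.  G1 is that statement for one drift; G2 turns a lower bound on EVERY late window into a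
lower bound on the honest `limsup` long-time mean (sliding windows); G3 is the single-shell enstrophy identity
(Alexakis–Doering 2006 §4, `⟨‖∇v‖²⟩ ≤ λE` when `−Δg = λg`); G4 assembles: no Stokes-eigenfield force carries a
W-witness.  Consequence for W (landed separately, `…TwohalfdThesisStrainGateWitness.lean`): every late window of
every low-viscosity member of a W-family carries planar strain `≥ c log(1/ν_j) − 1`, mean strain `≳ log(1/ν_j)/τ₀`,
mean enstrophy `≳ log²(1/ν_j)/τ₀²` — the exact threshold below which the sibling negative crux `TwohalfdNeg`
(stmt-0211, `stub_quietOfSubLog`) kills `X`. -/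

/-- **G1 `stub_strainGate` (M; the lead's) — LANDED p99595 (`Theorems/TwoAndHalfDTwohalfdThesisStubStrainGate.lean`).**  For a smooth pattern `h` on `T²` and a window length `τ₀ > 0` there
are `κ₀ ∈ (0,1)` and `C ≥ 0` (depending only on `sup|h|`, `sup‖∇h‖`, `τ₀`) such that for every diffusivity
`0 < κ ≤ κ₀`, every classical solution `φ` of `∂ₜφ + u·∇φ = κΔφ` on `[0, τ₀] × T²` (smooth divergence-free drift
`u`, part of the notion) released from `φ 0 = h`, and every strain budget `∫₀^{τ₀} ‖∇u(t)‖_{L²} dt ≤ S`: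
`(‖h‖² − ‖φ(τ₀)‖²)·log(1/κ) ≤ C (S + 1)` — variance lost on the window costs logarithmic strain.
PROOF ROUTE: energy identity `‖h‖² − ‖φ(τ₀)‖² = 2κ∫₀^{τ₀}‖∇φ‖²` (`scalarL2Sq_add_scalarDissipation_holds`) and
`releaseLogBound_smooth` (`eScalarDissipation_eq_ofReal` to pass to reals).  Leans on: `ReleaseLogBoundSmooth`,
`PassiveScalarClassicalEnergy`; nothing unproved. [folklore: Crippa–De Lellis 2008; Seis 2022 Lemma 3] -/
theorem stub_strainGate :
    ∀ (h : (UnitAddTorus (Fin 2)) → ℝ) (τ₀ : ℝ), Torus.IsSmooth h → 0 < τ₀ →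
      ∃ κ₀ C : ℝ, 0 < κ₀ ∧ κ₀ < 1 ∧ 0 ≤ C ∧
        ∀ (κ S : ℝ) (u : ℝ → (UnitAddTorus (Fin 2)) → (EuclideanSpace ℝ (Fin 2))) (φ : ℝ → (UnitAddTorus (Fin 2)) → ℝ),
          0 < κ → κ ≤ κ₀ → 0 ≤ S →
          Torus.IsClassicalScalarTransportOn (Icc 0 τ₀) κ u φ → φ 0 = h →
          ∫⁻ t in Ioo 0 τ₀, Torus.eGradNormSq (u t) ^ (1 / 2 : ℝ) ≤ ENNReal.ofReal S →
          (Torus.scalarL2Sq h - Torus.scalarL2Sq (φ τ₀)) * Real.log κ⁻¹ ≤ C * (S + 1) :=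
  Summit.AnomalousDissipation.AnomalousDissipation.Theorems.TwohalfdThesis.stub_strainGate

/-- **G1-W `stub_witnessStrainGate` (M; lead c2) — LANDED p104272 (`Theorems/TwoAndHalfDTwohalfdThesisStrainGateWitness.lean`) — G1 read in W's format.**  Classical releases `φ j s` of
one smooth `h` into the drifts `v j` at every time `s ≥ 0` (`φ j s s = h`), losing the fraction `δ` of `‖h‖²` by
age `τ₀ > 0` from every release time `s ≥ s₀` (W's envelope at ONE lossy lag): then there are `κ₀ ∈ (0,1)` and
`C > 0` such that EVERY late window of EVERY low-viscosity member carries logarithmic strain,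
`ofReal(δ‖h‖²·log(1/ν_j)/C − 1) ≤ ∫⁻_{(0,τ₀)} (‖∇v_j(s+τ)‖₂²)^{1/2} dτ` for `ν_j ≤ κ₀`, `s ≥ s₀`.
PROOF ROUTE: time shift `t ↦ t + s` (`isClassicalScalarTransportOn_comp_add_const`), restriction to
`[0, τ₀]`, G1.  Leans on: G1; nothing unproved. [folklore] -/
theorem stub_witnessStrainGate :
    ∀ (ν : ℕ → ℝ) (v : ℕ → ℝ → (UnitAddTorus (Fin 2)) → (EuclideanSpace ℝ (Fin 2))) (h : (UnitAddTorus (Fin 2)) → ℝ) (φ : ℕ → ℝ → ℝ → (UnitAddTorus (Fin 2)) → ℝ) (s₀ τ₀ δ : ℝ),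
      (∀ j, 0 < ν j) → Torus.IsSmooth h → 0 < τ₀ →
      (∀ j s, 0 ≤ s → Torus.IsClassicalScalarTransportOn (Ici s) (ν j) (v j) (φ j s) ∧ φ j s s = h) →
      0 ≤ s₀ →
      (∀ j s, s₀ ≤ s → Torus.scalarL2Sq (φ j s (s + τ₀)) ≤ (1 - δ) * Torus.scalarL2Sq h) →
      ∃ κ₀ C : ℝ, 0 < κ₀ ∧ κ₀ < 1 ∧ 0 < C ∧ ∀ j, ν j ≤ κ₀ → ∀ s, s₀ ≤ s →
        ENNReal.ofReal (δ * Torus.scalarL2Sq h * Real.log (ν j)⁻¹ / C - 1) ≤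
          ∫⁻ τ in Ioo 0 τ₀, Torus.eGradNormSq (v j (s + τ)) ^ (1 / 2 : ℝ) :=
  Summit.AnomalousDissipation.AnomalousDissipation.Theorems.TwohalfdThesis.stub_witnessStrainGate

/-- **G2 `stub_windowsToMean` (S/M; wave) — LANDED p99815 (`Theorems/TwoAndHalfDTwohalfdThesisStubWindowsToMean.lean`).**  Sliding-window bookkeeping on `(0, ∞)`: if an a.e.-measurable
`φ : ℝ → [0, ∞]`, locally finite (`∫⁻_{(0,T)} φ < ∞`), carries at least `A ≥ 0` on EVERY window `(s, s + c)` with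
`s ≥ s₀` (`ofReal A ≤ ∫⁻_{(0,c)} φ(s + τ) dτ`), and the running means of `φ.toReal` are eventually bounded above
(so that the real `limsup` is honest), then the `limsup` long-time mean of `φ.toReal` is `≥ A / c`.
PROOF ROUTE: Tonelli / `timeMean_toReal_window_le` pattern of `LongTimeAverageSlidingWindow` read from below:
`∫_{(0,T]} ∫⁻_{(0,c)} φ(s+τ) ≤ c ∫_{(0,T+c]} φ`, while the left side is `≥ A (T − s₀)`; hence
`⟨φ⟩_{T+c} ≥ A(T − s₀)/(c(T+c)) → A/c`, so `liminf ≥ A/c` and `limsup ≥ liminf` under boundedness.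
Leans on: `LongTimeAverageSlidingWindow`, `TurbWave0` (`timeMean`, `longTimeAvgSup`); nothing unproved. [folklore] -/
theorem stub_windowsToMean :
    ∀ (φ : ℝ → ℝ≥0∞) (A c s₀ : ℝ), AEMeasurable φ (volume.restrict (Ioi 0)) →
      (∀ T, 0 < T → ∫⁻ t in Ioo 0 T, φ t < ⊤) → 0 ≤ A → 0 < c → 0 ≤ s₀ →
      (∀ s, s₀ ≤ s → ENNReal.ofReal A ≤ ∫⁻ τ in Ioo 0 c, φ (s + τ)) →
      IsBoundedUnder (· ≤ ·) atTop (timeMean fun t => (φ t).toReal) →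
      A / c ≤ longTimeAvgSup (fun t => (φ t).toReal) :=
  Summit.AnomalousDissipation.AnomalousDissipation.Theorems.TwohalfdThesis.stub_windowsToMean

/-- **G3 `stub_shellEnstrophyBound` (M; wave) — LANDED p100009 (`Theorems/TwoAndHalfDTwohalfdThesisStubShellEnstrophyBound.lean`).**  Single-shell enstrophy identity (Alexakis–Doering 2006 §4,
Marchioro 1986): for a classical solution `(v, p)` of the planar Navier–Stokes system on `[0, ∞) × T²` with
viscosity `ν > 0`, steady smooth divergence-free mean-zero force `g` that is a Stokes eigenfield, `Δg = −λg`
(`λ > 0`), and pointwise energy `∫‖v(t)‖² ≤ E` (`t ≥ 0`), the honest `limsup` long-time mean enstrophy obeys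
`⟨‖∇v‖²_{L²}⟩ ≤ λ E`.
PROOF ROUTE: enstrophy balance `½‖∇v(T)‖² + ν∫₀ᵀ‖Δv‖² = ½‖∇v(0)‖² − ∫₀ᵀ⟪Δg, v⟫ = ½‖∇v(0)‖² + λ∫₀ᵀ⟪g, v⟫`
(tree: `fmrt_enstrophy_balance_torus2_holds` for the global Leray–Hopf solution the classical one is,
`IsClassicalNSSolutionOn.isLerayHopfOn_of_convex`; or the classical energy calculus), energy equality
`∫₀ᵀ⟪g,v⟫ = ½‖v(T)‖² − ½‖v(0)‖² + ν∫₀ᵀ‖∇v‖² ≤ E/2 + νT·Z_T` (`IsClassicalNSSolutionOn.energy_eq`), spectral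
interpolation `‖∇v‖⁴ ≤ ‖v‖²‖Δv‖²` (`AlexakisDoeringInterpolation`) and Jensen in time:
`Z_T ≤ √E·√P_T`, `P_T ≤ (‖∇v(0)‖² + λE)/(2νT) + λ Z_T`, whence `Z_T ≤ (λE + √(λ²E² + 4E a_T))/2 → λE`
(`Z_T`, `P_T` the running means of `‖∇v‖²`, `‖Δv‖²`); `longTimeAvgSup_le_of_eventually_le`-type bookkeeping.
Leans on: `NSEnstrophyBalance2D(Proofs)`, `AlexakisDoeringInterpolation/Proofs`, `TorusClassicalLerayHopfProofs`;
nothing unproved. [cite: AlexakisDoering2006PLA, §4] -/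
theorem stub_shellEnstrophyBound :
    ∀ (ν lam E : ℝ) (g : (UnitAddTorus (Fin 2)) → (EuclideanSpace ℝ (Fin 2))) (v : ℝ → (UnitAddTorus (Fin 2)) → (EuclideanSpace ℝ (Fin 2))) (p : ℝ → (UnitAddTorus (Fin 2)) → ℝ),
      0 < ν → 0 < lam → Torus.IsSmooth g → Torus.IsDivFree g → Torus.HasZeroMean g →
      (∀ x, Torus.laplacian g x = -(lam • g x)) →
      Torus.IsClassicalNSSolutionOn (Ici 0) ν (fun _ => g) v p →
      (∀ t, 0 ≤ t → ∫ x, ‖v t x‖ ^ 2 ≤ E) →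
      longTimeAvgSup (fun t => (Torus.eGradNormSq (v t)).toReal) ≤ lam * E :=
  Summit.AnomalousDissipation.AnomalousDissipation.Theorems.TwohalfdThesis.stub_shellEnstrophyBound

/-- **G4 `stub_shellNoGo` (M; lead c2's wave) — LANDED p111103 (`Theorems/TwoAndHalfDTwohalfdThesisStubShellNoGo.lean`).**  NO STOKES-EIGENFIELD FORCE CARRIES A W-WITNESS: the body of
`stub_releasedMixingWitness` with `Δg = −λg` (`λ > 0`) is contradictory.  PROOF ROUTE: G1 after the time shift
`t ↦ t + s` of each late release (autonomous equations, `isClassicalScalarTransportOn_comp_add_const`) at a lossy lag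
`τ₀` (`Λ(τ₀) ≤ 1/2` exists since `Λ ≥ 0` is integrable on `[0, ∞)`) gives window strain `≥ c log(1/ν_j) − 1` on every
window `[s, s + τ₀]`, `s ≥ s₀`, `c = 3‖h‖²/(4C) > 0` (`h ≠ 0` by the Green–Kubo floor); G2 (the strain
`t ↦ (‖∇v_j(t)‖²)^{1/2}` of a global Leray–Hopf solution is a.e.-measurable, locally integrable and has bounded
running means under a mean-zero force: `TwohalfdNeg.QuietOfSubLog` lemmas) gives mean strain `≥ (c log(1/ν_j) − 1)/τ₀`;
G3 and Jensen give mean strain `≤ √(λE)`; contradiction as `ν_j → 0`.  Leans on: G1–G3; nothing unproved.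
[cite: AlexakisDoering2006PLA, §4] -/
theorem stub_shellNoGo :
    ∀ (lam : ℝ) (g : (UnitAddTorus (Fin 2)) → (EuclideanSpace ℝ (Fin 2))) (h : (UnitAddTorus (Fin 2)) → ℝ),
      0 < lam → (∀ x, Torus.laplacian g x = -(lam • g x)) →
      Torus.IsSmooth g → Torus.IsDivFree g → Torus.HasZeroMean g → Torus.IsSmooth h → Torus.HasZeroMean h →
      ∀ (ν : ℕ → ℝ) (v : ℕ → ℝ → (UnitAddTorus (Fin 2)) → (EuclideanSpace ℝ (Fin 2))) (p : ℕ → ℝ → (UnitAddTorus (Fin 2)) → ℝ) (φ : ℕ → ℝ → ℝ → (UnitAddTorus (Fin 2)) → ℝ)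
        (Λ : ℝ → ℝ) (E s₀ M ε : ℝ),
        (∀ j, 0 < ν j) → Tendsto ν atTop (𝓝 0) →
        (∀ j, Torus.IsClassicalNSSolutionOn (Ici 0) (ν j) (fun _ => g) (v j) (p j)) →
        (∀ j t, 0 ≤ t → ∫ x, ‖v j t x‖ ^ 2 ≤ E) →
        (∀ j s, 0 ≤ s → Torus.IsClassicalScalarTransportOn (Ici s) (ν j) (v j) (φ j s) ∧ φ j s s = h) →
        0 ≤ s₀ → (∀ τ, 0 ≤ Λ τ) → IntegrableOn Λ (Ici 0) → (∫ τ in Ici 0, Λ τ) ≤ M →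
        (∀ j s t, s₀ ≤ s → s ≤ t → Torus.scalarL2Sq (φ j s t) ≤ Λ (t - s) ^ 2 * Torus.scalarL2Sq h) →
        0 < ε →
        (∀ j, ε ≤ liminf (timeMean fun t => ∫ s in (0 : ℝ)..t, ∫ x, h x * φ j s t x) atTop) →
        False :=
  Summit.AnomalousDissipation.AnomalousDissipation.Theorems.TwohalfdThesis.stub_shellNoGo

/-- **G5 `stub_witnessEnstrophyFloor` (M; lead c2) — LANDED p113878
(`Theorems/TwoAndHalfDTwohalfdThesisStrainGateEnstrophy.lean`).**  The mean-ENSTROPHY floor of a released family with a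
late loss: `(A_j/τ₀)² ≤ ⟨‖∇v_j‖₂²⟩` for every `j` with `ν_j ≤ κ₀`, `A_j = δ‖h‖² log(1/ν_j)/C − 1 ≥ 0` (G1-W + the
`liminf` form of G2 + Jensen).  Leans on: G1-W, G2; nothing unproved. [folklore] -/
theorem stub_witnessEnstrophyFloor :
    ∀ (ν : ℕ → ℝ) (g : (UnitAddTorus (Fin 2)) → (EuclideanSpace ℝ (Fin 2))) (v : ℕ → ℝ → (UnitAddTorus (Fin 2)) → (EuclideanSpace ℝ (Fin 2))) (p : ℕ → ℝ → (UnitAddTorus (Fin 2)) → ℝ) (h : (UnitAddTorus (Fin 2)) → ℝ) (φ : ℕ → ℝ → ℝ → (UnitAddTorus (Fin 2)) → ℝ) (s₀ τ₀ δ : ℝ),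
      (∀ j, 0 < ν j) → Torus.IsSmooth g → Torus.HasZeroMean g →
      (∀ j, Torus.IsClassicalNSSolutionOn (Ici 0) (ν j) (fun _ => g) (v j) (p j)) →
      Torus.IsSmooth h → 0 < τ₀ →
      (∀ j s, 0 ≤ s → Torus.IsClassicalScalarTransportOn (Ici s) (ν j) (v j) (φ j s) ∧ φ j s s = h) →
      0 ≤ s₀ →
      (∀ j s, s₀ ≤ s → Torus.scalarL2Sq (φ j s (s + τ₀)) ≤ (1 - δ) * Torus.scalarL2Sq h) →
      ∃ κ₀ C : ℝ, 0 < κ₀ ∧ κ₀ < 1 ∧ 0 < C ∧ ∀ j, ν j ≤ κ₀ →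
        0 ≤ δ * Torus.scalarL2Sq h * Real.log (ν j)⁻¹ / C - 1 →
        ((δ * Torus.scalarL2Sq h * Real.log (ν j)⁻¹ / C - 1) / τ₀) ^ 2 ≤
          longTimeAvgSup (fun t => (Torus.eGradNormSq (v j t)).toReal) :=
  Summit.AnomalousDissipation.AnomalousDissipation.Theorems.TwohalfdThesis.stub_witnessEnstrophyFloor

/-! ## H — the Green–Kubo floor is automatic for fast mixers (lead c3, 2026-08-16)

Registered tool stubs of lead c3.  Mechanism: the landed coherence gate (p97305) says a release of `h` stays
correlated with `h` for the coherence time `τ_c = ‖h‖²/K`, `K = (‖Δh‖₂ + ‖∇h‖_∞√E)‖h‖₂`; if W's envelope has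
a small TAIL beyond `τ_c` (`∫_{[τ_c,∞)} Λ ≤ τ_c/4`), the Duhamel integral `∫₀ᵗ ⟪h, φ s (t)⟫ ds` is eventually
`≥ ‖h‖²τ_c/4 - o(1)` (young ages by coherence, middle ages by the envelope tail, early releases by the
fixed-diffusivity decay p98636), so W's Green–Kubo clause HOLDS with `ε = ‖h‖²τ_c/4`.  Hence the kernel of
the line is ONE property: a `j`-uniform integrable mixing envelope with a quantified tail (W_tail ⇒ W). -/

/-- **H1-tools `stub_gkFloorOfTailTools` (M; lead c3) — LANDED p116589 (`Theorems/TwoAndHalfDTwohalfdThesisStubGKFloorOfTailTools.lean`).**  (i) continuity of the datum correlation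
`s ↦ ⟪h, φ s (t)⟫` in the release time on `[0,t]` (forward–backward duality with the reversed solution
from `h`, as in D0); (ii) Cesàro bookkeeping: an eventually `≥ a - δ` (every `δ > 0`), bounded, locally
integrable signal has `liminf` of running means `≥ a`; (iii) the one-time lower bound
`‖h‖²τ_c/4 - s₀‖h‖²√(e^{-8π²κ(t-s₀)}) ≤ ∫₀ᵗ ⟪h, φ s (t)⟫ ds` for `t ≥ s₀ + τ_c` under a coherence rate `K`,
W's envelope after `s₀` and the tail condition.  Leans on: D0's duality lemmas (p87403), P1 fixed-ν
envelope (p98636), D1's Cauchy–Schwarz/splitting lemmas (p88959); nothing unproved. [folklore] -/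
theorem stub_gkFloorOfTailTools :
    (∀ (κ t : ℝ) (u : ℝ → (UnitAddTorus (Fin 2)) → (EuclideanSpace ℝ (Fin 2))) (h : (UnitAddTorus (Fin 2)) → ℝ)
        (φ : ℝ → ℝ → (UnitAddTorus (Fin 2)) → ℝ),
        0 < κ → 0 < t → Torus.IsSmooth h →
        (∀ s, 0 ≤ s → Torus.IsClassicalScalarTransportOn (Ici s) κ u (φ s) ∧ φ s s = h) →
        ∃ D : ℝ → ℝ, ContinuousOn D (Icc 0 t) ∧ ∀ s ∈ Icc 0 t, ∫ x, h x * φ s t x = D s) ∧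
    (∀ (P : ℝ → ℝ) (a B₀ : ℝ),
        (∀ T, 0 ≤ T → IntervalIntegrable P volume 0 T) → (∀ t, 0 < t → |P t| ≤ B₀) →
        (∀ δ, 0 < δ → ∃ T₁, 0 ≤ T₁ ∧ ∀ t, T₁ ≤ t → a - δ ≤ P t) →
        a ≤ liminf (timeMean P) atTop) ∧
    (∀ (κ K s₀ t : ℝ) (u : ℝ → (UnitAddTorus (Fin 2)) → (EuclideanSpace ℝ (Fin 2))) (h : (UnitAddTorus (Fin 2)) → ℝ)
        (φ : ℝ → ℝ → (UnitAddTorus (Fin 2)) → ℝ) (Λ : ℝ → ℝ),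
        0 < κ → Torus.IsSmooth h → Torus.HasZeroMean h → 0 < K →
        (∀ s, 0 ≤ s → Torus.IsClassicalScalarTransportOn (Ici s) κ u (φ s) ∧ φ s s = h) →
        (∀ s r, 0 ≤ s → s ≤ r → Torus.scalarL2Sq h - K * (r - s) ≤ ∫ x, h x * φ s r x) →
        0 ≤ s₀ → (∀ τ, 0 ≤ Λ τ) → IntegrableOn Λ (Ici 0) →
        (∀ s r, s₀ ≤ s → s ≤ r → Torus.scalarL2Sq (φ s r) ≤ Λ (r - s) ^ 2 * Torus.scalarL2Sq h) →
        (∫ τ in Ici (Torus.scalarL2Sq h / K), Λ τ) ≤ Torus.scalarL2Sq h / K / 4 →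
        s₀ + Torus.scalarL2Sq h / K ≤ t →
        Torus.scalarL2Sq h * (Torus.scalarL2Sq h / K) / 4 -
            s₀ * Torus.scalarL2Sq h * Real.sqrt (Real.exp (-(8 * Real.pi ^ 2 * κ) * (t - s₀))) ≤
          ∫ s in (0 : ℝ)..t, ∫ x, h x * φ s t x) :=
  Summit.AnomalousDissipation.AnomalousDissipation.Theorems.TwohalfdThesis.stub_gkFloorOfTailTools

/-- **H1 `stub_gkFloorOfTail` (M; lead c3) — LANDED p118430 (`Theorems/TwoAndHalfDTwohalfdThesisStubGKFloorOfTail.lean`) — W's Green–Kubo clause from W's envelope with a small tail.**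
In W's format: `0 < κ ≤ 1`, a drift with pointwise kinetic energy `∫‖u(t)‖² ≤ E` (`t ≥ 0`), a smooth
zero-mean `h`, classical unforced releases `φ s` of `h` at every `s ≥ 0`, an envelope `Λ ≥ 0` integrable
on `[0,∞)` with `‖φ s (t)‖² ≤ Λ(t-s)²‖h‖²` for `s₀ ≤ s ≤ t`; with the coherence rate of the landed
coherence gate `K = (‖Δh‖₂ + ‖∇h‖_∞√E)‖h‖₂ > 0` and `τ_c = ‖h‖²/K`: if `∫_{[τ_c,∞)} Λ ≤ τ_c/4` then
`‖h‖²τ_c/4 ≤ liminf_T T⁻¹∫₀ᵀ (∫₀ᵗ ⟪h, φ s (t)⟫ ds) dt`.  PROOF ROUTE: H1-tools (iii) at every late time,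
the early-release error `→ 0`, the Duhamel integral is locally integrable (`= ⟪h, θ(t)⟫` for the cold
start, D0) and bounded (`≤ (s₀ + ∫Λ)‖h‖²`, D1's splitting estimate), H1-tools (ii); coherence from F1
`stub_coherenceOfEnergy` (p97305).  Leans on: H1-tools, D0, D1, F1, P1; nothing unproved. [folklore] -/
theorem stub_gkFloorOfTail :
    ∀ (κ E K s₀ : ℝ) (u : ℝ → (UnitAddTorus (Fin 2)) → (EuclideanSpace ℝ (Fin 2)))
      (h : (UnitAddTorus (Fin 2)) → ℝ) (φ : ℝ → ℝ → (UnitAddTorus (Fin 2)) → ℝ) (Λ : ℝ → ℝ),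
      0 < κ → κ ≤ 1 → Torus.IsSmooth h → Torus.HasZeroMean h →
      K = (Real.sqrt (Torus.scalarL2Sq (Torus.laplacian h)) +
            (⨆ x, ‖Torus.gradient h x‖) * Real.sqrt E) * Real.sqrt (Torus.scalarL2Sq h) →
      0 < K →
      (∀ t, 0 ≤ t → ∫ x, ‖u t x‖ ^ 2 ≤ E) →
      (∀ s, 0 ≤ s → Torus.IsClassicalScalarTransportOn (Ici s) κ u (φ s) ∧ φ s s = h) →
      0 ≤ s₀ → (∀ τ, 0 ≤ Λ τ) → IntegrableOn Λ (Ici 0) →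
      (∀ s t, s₀ ≤ s → s ≤ t → Torus.scalarL2Sq (φ s t) ≤ Λ (t - s) ^ 2 * Torus.scalarL2Sq h) →
      (∫ τ in Ici (Torus.scalarL2Sq h / K), Λ τ) ≤ Torus.scalarL2Sq h / K / 4 →
      Torus.scalarL2Sq h * (Torus.scalarL2Sq h / K) / 4 ≤
        liminf (timeMean fun t => ∫ s in (0 : ℝ)..t, ∫ x, h x * φ s t x) atTop :=
  Summit.AnomalousDissipation.AnomalousDissipation.Theorems.TwohalfdThesis.stub_gkFloorOfTail

/-- **H2 `stub_gkLimsupNecessary` (S/M; lead c3, wave) — LANDED p117026 (`Theorems/TwoAndHalfDTwohalfdThesisStubGKLimsupNecessary.lean`) — the Green–Kubo clause is NECESSARY in `limsup` form.**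
For the classical cold start `θ` (source `h`, `θ(0) = 0`, `κ > 0`) over one drift with bounded variance
`‖θ(t)‖² ≤ B` (`t ≥ 0`) and the classical releases `φ s` of `h` (`s ≥ 0`): a limsup-mean DISSIPATION floor
`ε ≤ ⟨κ‖∇θ‖²⟩` forces the limsup-mean Green–Kubo floor `ε ≤ limsup_T T⁻¹∫₀ᵀ (∫₀ᵗ ⟪h, φ s (t)⟫ ds) dt`.
So W's GK clause differs from what X itself needs only by `liminf` vs `limsup`.  PROOF ROUTE: D2's Cesàro
identity `dissipationFloor_timeMean_eq` (p89988): `T⁻¹∫₀ᵀκ‖∇θ‖² = T⁻¹∫₀ᵀ⟪h,θ⟫ − (‖θ(T)‖² − ‖θ(0)‖²)/(2T) ≤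
T⁻¹∫₀ᵀ⟪h,θ⟫ + B/(2T)`, the power means are bounded (`|⟪h,θ⟫| ≤ ‖h‖√B`), so `limsup` power `≥ limsup`
dissipation `≥ ε` (`Filter.le_limsup_of_frequently_le` / `limsup_le_limsup` bookkeeping as in
`dissipationFloor_le_limsup`); then `⟪h, θ(t)⟫ = ∫₀ᵗ ⟪h, φ s (t)⟫ ds` for `t ≥ 0` by D0 `stub_weakDuhamel`
(p87403, `χ := h`, commute the integrand), and `timeMean` only sees `t > 0` (`timeMean_congr`).  Leans on:
D0, D2's toolkit; nothing unproved. [folklore] -/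
theorem stub_gkLimsupNecessary :
    ∀ (κ B ε : ℝ) (u : ℝ → (UnitAddTorus (Fin 2)) → (EuclideanSpace ℝ (Fin 2))) (h : (UnitAddTorus (Fin 2)) → ℝ)
      (θ : ℝ → (UnitAddTorus (Fin 2)) → ℝ) (φ : ℝ → ℝ → (UnitAddTorus (Fin 2)) → ℝ),
      0 < κ → Torus.IsSmooth h →
      Torus.IsClassicalScalarTransportForcedOn (Ici 0) κ u (fun _ => h) θ → θ 0 = (fun _ => (0 : ℝ)) →
      (∀ s, 0 ≤ s → Torus.IsClassicalScalarTransportOn (Ici s) κ u (φ s) ∧ φ s s = h) →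
      (∀ t, 0 ≤ t → Torus.scalarL2Sq (θ t) ≤ B) →
      ε ≤ longTimeAvgSup (fun t => κ * (Torus.eScalarGradNormSq (θ t)).toReal) →
      ε ≤ limsup (timeMean fun t => ∫ s in (0 : ℝ)..t, ∫ x, h x * φ s t x) atTop :=
  Summit.AnomalousDissipation.AnomalousDissipation.Theorems.TwohalfdThesis.stub_gkLimsupNecessary

/-- **H3 `stub_unforcedNoGo` (M; lead c3, wave) — LANDED p118146 (`Theorems/TwoAndHalfDTwohalfdThesisStubUnforcedNoGo.lean`) — NO UNFORCED PLANAR FLOW CARRIES A W-WITNESS (`g = 0`).**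
The body of W with `g = 0` is contradictory: the planar flow must be DRIVEN.  PROOF ROUTE: GK floor ⇒ `h ≠ 0`
(`scalarL2Sq_pos_of_ne_zero`, as in G4); integrable envelope ⇒ lossy lag `τ₀` with loss `δ = 3/4` from every
`s ≥ s₀` (`exists_pos_lag_le_half`); `releasedFamily_logStrain` (p104272): `κ₀, C` with
`δ‖h‖² log(1/ν_j) ≤ C(S+1)` whenever `ν_j ≤ κ₀`, `s ≥ s₀` and the window strain `∫⁻_{(0,τ₀)}(‖∇v_j(s+τ)‖₂²)^{1/2} ≤ ofReal S`;
pick `j` with `ν_j ≤ κ₀` and `δ‖h‖² log(1/ν_j) > 2C` (`tendsto_log_inv_atTop_of_tendsto_zero`); for THIS `j` the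
UNFORCED classical energy equality (`IsClassicalNSSolutionOn.energy_eq`, force `0`, power term `0`) gives
`ν_j∫₀ᵀ‖∇v_j‖² ≤ ½∫‖v_j(0)‖² ≤ E/2` for all `T`, so by pigeonhole over the disjoint windows
`[s₀+kτ₀, s₀+(k+1)τ₀]` some late window has `∫‖∇v_j‖² ≤ 1/τ₀`, hence (Cauchy–Schwarz / Jensen
`timeMean_sqrt_le_sqrt_timeMean`, `eGradNormSq = ofReal gradNormSq` on smooth slices) window strain `≤ ofReal 1`;
`S = 1` gives `δ‖h‖² log(1/ν_j) ≤ 2C` — contradiction.  Leans on: G1-W's file (p104272), TorusClassicalLerayHopfProofs;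
nothing unproved. [folklore] -/
theorem stub_unforcedNoGo :
    ∀ (g : (UnitAddTorus (Fin 2)) → (EuclideanSpace ℝ (Fin 2))) (h : (UnitAddTorus (Fin 2)) → ℝ),
      g = 0 → Torus.IsSmooth h → Torus.HasZeroMean h →
      ∀ (ν : ℕ → ℝ) (v : ℕ → ℝ → (UnitAddTorus (Fin 2)) → (EuclideanSpace ℝ (Fin 2))) (p : ℕ → ℝ → (UnitAddTorus (Fin 2)) → ℝ)
        (φ : ℕ → ℝ → ℝ → (UnitAddTorus (Fin 2)) → ℝ) (Λ : ℝ → ℝ) (E s₀ M ε : ℝ),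
        (∀ j, 0 < ν j) → Tendsto ν atTop (𝓝 0) →
        (∀ j, Torus.IsClassicalNSSolutionOn (Ici 0) (ν j) (fun _ => g) (v j) (p j)) →
        (∀ j t, 0 ≤ t → ∫ x, ‖v j t x‖ ^ 2 ≤ E) →
        (∀ j s, 0 ≤ s → Torus.IsClassicalScalarTransportOn (Ici s) (ν j) (v j) (φ j s) ∧ φ j s s = h) →
        0 ≤ s₀ → (∀ τ, 0 ≤ Λ τ) → IntegrableOn Λ (Ici 0) → (∫ τ in Ici 0, Λ τ) ≤ M →
        (∀ j s t, s₀ ≤ s → s ≤ t → Torus.scalarL2Sq (φ j s t) ≤ Λ (t - s) ^ 2 * Torus.scalarL2Sq h) →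
        0 < ε →
        (∀ j, ε ≤ liminf (timeMean fun t => ∫ s in (0 : ℝ)..t, ∫ x, h x * φ j s t x) atTop) →
        False :=
  Summit.AnomalousDissipation.AnomalousDissipation.Theorems.TwohalfdThesis.stub_unforcedNoGo

/-! ## J — junction with the sibling negative crux (lead c3, 2026-08-16)

The two crux chains of the route meet in ONE 2-D statement: the REGISTERED residual stub S6 `stub_subLogStrain`
of `TwohalfdNeg` (stmt-0211, line `log-kantorovich-enstrophy-transfer`) — bounded-energy global Leray–Hopf families
of steadily forced 2-D NS have `⟨‖∇v_j‖₂⟩/log(1/ν_j) → 0` — REFUTES the kernel W of this line (strain gate G1–G4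
in W's format + Leray–Hopf bookkeeping).  So: S6 proved ⇒ this line is dead (and ¬X by the sibling certificate);
a W-witness needs a bounded-energy steadily forced planar family with `limsup_j ⟨‖∇v_j‖₂⟩/log(1/ν_j) > 0`. -/

/-- **J1 `stub_releasedMixingWitness_false_of_subLogStrain` (S; lead c3) — LANDED p118382 (`Theorems/TwoAndHalfDTwohalfdThesisSubLogKillsW.lean`).**  `(signature of 0211's S6
stub_subLogStrain, verbatim, as a hypothesis) → ¬ (body of W)`.  PROOF ROUTE: GK floor ⇒ `h ≠ 0`; integrable
envelope ⇒ lossy lag `τ₀` (loss 3/4 from every late release); c2's bridge `releasedFamily_not_subLogStrain`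
(p111103) ⇒ `¬(⟨‖∇v_j‖₂⟩/log → 0)`; the classical family is global Leray–Hopf from its slices with mean energy
`≤ E` (`meanEnergy_le_of_forall_le`), so S6 applies.  Leans on: G4's file (p111103); S6 itself is OPEN and only
a hypothesis. [folklore] -/
theorem stub_releasedMixingWitness_false_of_subLogStrain :
    (∀ g : UnitAddTorus (Fin 2) → EuclideanSpace ℝ (Fin 2), Torus.IsSmooth g → Torus.IsDivFree g →
      Torus.HasZeroMean g →
      ∀ (ν : ℕ → ℝ) (v₀ : ℕ → UnitAddTorus (Fin 2) → EuclideanSpace ℝ (Fin 2))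
        (v : ℕ → ℝ → UnitAddTorus (Fin 2) → EuclideanSpace ℝ (Fin 2)),
        (∀ j, 0 < ν j) → Tendsto ν atTop (𝓝 0) →
        (∀ j, Torus.IsGlobalLerayHopf (ν j) (fun _ => g) (v₀ j) (v j)) →
        (∃ E : ℝ, ∀ j, meanEnergy (v j) ≤ E) →
        Tendsto (fun j => longTimeAvgSup (fun t => Real.sqrt (Torus.eGradNormSq (v j t)).toReal) /
          Real.log (ν j)⁻¹) atTop (𝓝 0)) →
    ¬ (∃ (g : (UnitAddTorus (Fin 2)) → (EuclideanSpace ℝ (Fin 2))) (h : (UnitAddTorus (Fin 2)) → ℝ),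
        Torus.IsSmooth g ∧ Torus.IsDivFree g ∧ Torus.HasZeroMean g ∧ Torus.IsSmooth h ∧ Torus.HasZeroMean h ∧
        ∃ (ν : ℕ → ℝ) (v : ℕ → ℝ → (UnitAddTorus (Fin 2)) → (EuclideanSpace ℝ (Fin 2)))
          (p : ℕ → ℝ → (UnitAddTorus (Fin 2)) → ℝ) (φ : ℕ → ℝ → ℝ → (UnitAddTorus (Fin 2)) → ℝ)
          (Λ : ℝ → ℝ) (E s₀ M ε : ℝ),
          (∀ j, 0 < ν j) ∧ Tendsto ν atTop (𝓝 0) ∧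
          (∀ j, Torus.IsClassicalNSSolutionOn (Ici 0) (ν j) (fun _ => g) (v j) (p j)) ∧
          (∀ j t, 0 ≤ t → ∫ x, ‖v j t x‖ ^ 2 ≤ E) ∧
          (∀ j s, 0 ≤ s → Torus.IsClassicalScalarTransportOn (Ici s) (ν j) (v j) (φ j s) ∧ φ j s s = h) ∧
          0 ≤ s₀ ∧ (∀ τ, 0 ≤ Λ τ) ∧ IntegrableOn Λ (Ici 0) ∧ (∫ τ in Ici 0, Λ τ) ≤ M ∧
          (∀ j s t, s₀ ≤ s → s ≤ t → Torus.scalarL2Sq (φ j s t) ≤ Λ (t - s) ^ 2 * Torus.scalarL2Sq h) ∧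
          0 < ε ∧
          (∀ j, ε ≤ liminf (timeMean fun t => ∫ s in (0 : ℝ)..t, ∫ x, h x * φ j s t x) atTop)) :=
  Summit.AnomalousDissipation.AnomalousDissipation.Theorems.TwohalfdThesis.stub_releasedMixingWitness_false_of_subLogStrain

/-- **J2 `stub_releasedMixingWitness_of_profileMixerRealizable` (M; lead c3) — LANDED p132866
(`Theorems/TwoAndHalfDTwohalfdThesisWOfProfileMixer.lean`).**  `(body of 0448's kernel S1' stub_profileMixerRealizable,
verbatim) → (body of W)`: the sibling crux's profile-mixer spec (antitone square-integrable release profile `ρm` valid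
on every window from every `s ≥ 0`, plus a finite-lag cold-start correlation floor `c₀` at lag `L`) realises W with
`Λ := ρm` (extended by `ρm 0` on the left), `s₀ := 0`, `M := R`, and the GK floor `ε := c₀/2` obtained from the
cold-start floor by the landed GK-floor-of-tail tools (H1) and Young–Duhamel on windows.  So the route's two positive
kernels are ordered: S1' ⇒ W. [folklore] -/
theorem stub_releasedMixingWitness_of_profileMixerRealizable :
    (∃ (g : UnitAddTorus (Fin 2) → EuclideanSpace ℝ (Fin 2)) (h : UnitAddTorus (Fin 2) → ℝ),
        Torus.IsSmooth g ∧ Torus.IsDivFree g ∧ Torus.HasZeroMean g ∧ Torus.IsSmooth h ∧ Torus.HasZeroMean h ∧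
        ∃ (ν : ℕ → ℝ) (v : ℕ → ℝ → UnitAddTorus (Fin 2) → EuclideanSpace ℝ (Fin 2))
          (p : ℕ → ℝ → UnitAddTorus (Fin 2) → ℝ) (ρm : ℝ → ℝ) (E R L c₀ : ℝ),
          (∀ j, 0 < ν j) ∧ Tendsto ν atTop (𝓝 0) ∧ 0 < L ∧ 0 < c₀ ∧ Antitone ρm ∧ (∀ r, 0 ≤ ρm r) ∧
          (∀ t, 0 ≤ t → ∫ r in (0 : ℝ)..t, ρm r ≤ R) ∧
          (∀ t, L ≤ t → Torus.scalarL2Sq h * ∫ r in L..t, ρm r ≤ c₀ / 2) ∧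
          (∀ j, Torus.IsClassicalNSSolutionOn (Set.Ici 0) (ν j) (fun _ => g) (v j) (p j)) ∧
          (∀ j t, 0 ≤ t → ∫ x, ‖v j t x‖ ^ 2 ≤ E) ∧
          (∀ j (s T' : ℝ), 0 ≤ s → ∀ φ : ℝ → UnitAddTorus (Fin 2) → ℝ,
            Torus.IsClassicalScalarTransportOn (Set.Icc s T') (ν j) (v j) φ → φ s = h →
            ∀ t ∈ Set.Icc s T', Torus.scalarL2Sq (φ t) ≤ ρm (t - s) ^ 2 * Torus.scalarL2Sq h) ∧
          (∀ j (s : ℝ), 0 ≤ s → ∀ θ' : ℝ → UnitAddTorus (Fin 2) → ℝ,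
            Torus.IsClassicalScalarTransportForcedOn (Set.Icc s (s + L)) (ν j) (v j) (fun _ => h) θ' →
            θ' s = (fun _ => (0 : ℝ)) → c₀ ≤ ∫ x, h x * θ' (s + L) x)) →
      ∃ (g : (UnitAddTorus (Fin 2)) → (EuclideanSpace ℝ (Fin 2))) (h : (UnitAddTorus (Fin 2)) → ℝ),
        Torus.IsSmooth g ∧ Torus.IsDivFree g ∧ Torus.HasZeroMean g ∧ Torus.IsSmooth h ∧ Torus.HasZeroMean h ∧
        ∃ (ν : ℕ → ℝ) (v : ℕ → ℝ → (UnitAddTorus (Fin 2)) → (EuclideanSpace ℝ (Fin 2)))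
          (p : ℕ → ℝ → (UnitAddTorus (Fin 2)) → ℝ) (φ : ℕ → ℝ → ℝ → (UnitAddTorus (Fin 2)) → ℝ)
          (Λ : ℝ → ℝ) (E s₀ M ε : ℝ),
          (∀ j, 0 < ν j) ∧ Tendsto ν atTop (𝓝 0) ∧
          (∀ j, Torus.IsClassicalNSSolutionOn (Ici 0) (ν j) (fun _ => g) (v j) (p j)) ∧
          (∀ j t, 0 ≤ t → ∫ x, ‖v j t x‖ ^ 2 ≤ E) ∧
          (∀ j s, 0 ≤ s → Torus.IsClassicalScalarTransportOn (Ici s) (ν j) (v j) (φ j s) ∧ φ j s s = h) ∧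
          0 ≤ s₀ ∧ (∀ τ, 0 ≤ Λ τ) ∧ IntegrableOn Λ (Ici 0) ∧ (∫ τ in Ici 0, Λ τ) ≤ M ∧
          (∀ j s t, s₀ ≤ s → s ≤ t → Torus.scalarL2Sq (φ j s t) ≤ Λ (t - s) ^ 2 * Torus.scalarL2Sq h) ∧
          0 < ε ∧
          (∀ j, ε ≤ liminf (timeMean fun t => ∫ s in (0 : ℝ)..t, ∫ x, h x * φ j s t x) atTop) :=
  Summit.AnomalousDissipation.AnomalousDissipation.Theorems.TwohalfdThesis.stub_releasedMixingWitness_of_profileMixerRealizable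

/-! ## L — the crux is DECIDED BY ITS SIBLINGS (lead c4, 2026-08-17)

Since 2026-08-16T22:28Z the tree proves, on the negative crux's side, the identification of the route target with
crux #2 and of crux #5 with its negation (`Theorems.TwohalfdNeg.PlanarIdentification`, p128538; glue hypothesis
`ScalarLiftGlueR` = the landed `Theorems.scalarLiftGlueR_proof`), next to the kill shape `¬X ↔ TwohalfdNeg` (p74035).
Read unconditionally (0206-keyed certificate `Theorems/TwoAndHalfDTwohalfdThesisSiblingReduction.lean`, tools stub
`stub_siblingReduction`, p133429): `X ↔ ScalarAnomalySteadySourceFormal`, `¬X ↔ TwohalfdNeg`,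
`TwohalfdNeg ↔ ¬ScalarAnomalySteadySourceFormal`.  Consequences for THIS line: (i) W, the only open stub, is
sandwiched between the sibling kernels — S1' ⇒ W (J2) ⇒ X ∧ #2 (shared core p96811), S6 ⇒ ¬W (J1); (ii) every proof
or refutation of X is by name a proof or refutation of crux #2, on which two other lead chains are seated (0448, 0211);
(iii) the two CLOSING TEMPLATES of stmt-0206 are one-liners over the sibling outcomes (below). -/

/-- **L1 — `X ↔ crux #2`, unconditional** (PlanarIdentification with `hG := scalarLiftGlueR_proof`). [folklore] -/
theorem twohalfdThesis_iff_scalarAnomalySteadySourceFormal : TwohalfdThesis ↔ ScalarAnomalySteadySourceFormal :=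
  Summit.AnomalousDissipation.AnomalousDissipation.Theorems.TwohalfdNeg.PlanarIdentification.twohalfdThesis_iff_scalarAnomalySteadySourceFormal
    Summit.AnomalousDissipation.AnomalousDissipation.Theorems.scalarLiftGlueR_proof

/-- **L2 — `¬X ↔ crux #5`** (kill shape, p74035). [folklore] -/
theorem not_twohalfdThesis_iff_twohalfdNeg : ¬ TwohalfdThesis ↔ TwohalfdNeg :=
  Summit.AnomalousDissipation.AnomalousDissipation.Theorems.TwohalfdNeg.Negative.twohalfdNeg_iff_not_twohalfdThesis.symm

/-- **L3 — closing template (proved side):** a proof of crux #2 (stmt-0448) closes this crux. [folklore] -/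
theorem TwohalfdThesis_of_crux2 (h2 : ScalarAnomalySteadySourceFormal) : TwohalfdThesis :=
  twohalfdThesis_iff_scalarAnomalySteadySourceFormal.2 h2

/-- **L4 — closing template (refuted side):** a proof of crux #5 (stmt-0211) refutes this crux. [folklore] -/
theorem not_TwohalfdThesis_of_crux5 (h5 : TwohalfdNeg) : ¬ TwohalfdThesis :=
  not_twohalfdThesis_iff_twohalfdNeg.2 h5

/-! ## M — the NEGATIVE LEMMA on this item and the disprover's near-misses (lead c6, 2026-08-17)

Landed `--negative-modulo SubLogStrain --supports 0206` (p135209,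
`Theorems/TwohalfdThesis/Negative/TwohalfdThesisFalseOfSubLogStrain.lean`): the crux is FALSE modulo ONE purely
two-dimensional Navier–Stokes statement, `Negative.SubLogStrain` (`@[conjecture]`; verbatim the negative crux's
registered kernel S6 `stub_subLogStrain`): `SubLogStrain → ¬ TwohalfdThesis` (0211's transfer certificate
`Certificate.twohalfdNeg_of_subLogStrain`, then L4).  With J1 (S6 ⇒ ¬W) the picture for THIS line is: S6 kills both
the kernel W and the crux X by name; ¬S6 (log strain somewhere) is necessary for X and is exactly what the strain gate G
demands of W-witnesses window by window.  The same file turns the crux disprover's three paper near-misses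
(`Cruxes/TwohalfdThesis/Disproof.lean` §4, `sorry` there) into theorems in X's `∃`-language:
`Negative.not_twohalfdThesis_verticalForce` (f = (0,0,h)), `Negative.not_twohalfdThesis_planarForce` (f = (g,0): the
third component must be sourced), `Negative.not_twohalfdThesis_singleShell` / `Negative.not_twohalfdThesis_stokesEigenfield`
(Δf = −4π²K f).  So a witness of X needs: a sourced third component, a planar force on ≥ 2 shells, and a planar
Leray–Hopf family with `limsup`-mean strain `≳ log(1/ν_j)` (¬S6) at bounded energy. -/

/-- **M1 — the negative lemma by name:** `SubLogStrain → ¬X` (p135209). [folklore] -/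
theorem not_TwohalfdThesis_of_subLogStrain
    (hS6 : Summit.AnomalousDissipation.AnomalousDissipation.Theorems.TwohalfdThesis.Negative.SubLogStrain) :
    ¬ TwohalfdThesis :=
  Summit.AnomalousDissipation.AnomalousDissipation.Theorems.TwohalfdThesis.Negative.TwohalfdThesis_false_of_SubLogStrain hS6

/-- **M2 — near-miss (planar force), by name:** no witness of X has an unsourced third component. [folklore] -/
theorem not_twohalfdThesis_planarForce :
    ¬ ∃ g : UnitAddTorus (Fin 2) → EuclideanSpace ℝ (Fin 2), Torus.IsSmooth g ∧ Torus.IsDivFree g ∧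
      Torus.HasZeroMean g ∧
      ∃ (ν : ℕ → ℝ) (u₀ : ℕ → UnitAddTorus (Fin 3) → EuclideanSpace ℝ (Fin 3))
        (u : ℕ → ℝ → UnitAddTorus (Fin 3) → EuclideanSpace ℝ (Fin 3)),
        (∀ j, 0 < ν j) ∧ Tendsto ν atTop (𝓝 0) ∧
        (∀ j, Torus.IsGlobalLerayHopf (ν j) (fun _ => Torus.twoHalf g 0) (u₀ j) (u j)) ∧
        (∀ j (t : ℝ) (s : UnitAddCircle) (x : UnitAddTorus (Fin 3)), u j t (x + Pi.single (2 : Fin 3) s) = u j t x) ∧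
        (∃ E : ℝ, ∀ j, meanEnergy (u j) ≤ E) ∧
        ∃ ε : ℝ, 0 < ε ∧ ∀ j, ε ≤ meanDissipation (ν j) (u j) :=
  Summit.AnomalousDissipation.AnomalousDissipation.Theorems.TwohalfdThesis.Negative.not_twohalfdThesis_planarForce

/-! ## N — SOBOLEV CONDENSATES: no X-witness condenses onto bounded-enstrophy comparison flows (lead c7, 2026-08-17)

The sibling lead 0211-c7 proved the REGULAR-CONDENSATE theorem (`Theorems.TwohalfdNeg.RegularCondensate`,
p135386): if the planar flow of a family is `limsup`-mean `L²`-asymptotic to comparison flows `W_j` that are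
uniformly bounded and uniformly LIPSCHITZ in space–time, the steady-source scalar anomaly vanishes.  Lead c7 of
THIS crux frees the theorem from the Lipschitz requirement: it suffices that the comparison flows have
UNIFORMLY BOUNDED ENSTROPHY `‖∇W_j(t)‖²_{L²} ≤ G` and UNIFORMLY BOUNDED `L²`-SPEED
`‖W_j(t) − W_j(s)‖_{L²} ≤ B|t−s|` (bounded continuous, weakly divergence free) — vortex-PATCH-type coherent
structures (bounded vorticity, log-Lipschitz but not Lipschitz velocity), drifting and deforming with bounded
`L²`-speed, `j`-dependent.  Engine: the κ = 0 DiPerna–Lions conservative balance for SOBOLEV drifts, LANDED by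
c7 as `Literature.Analysis.FluidPDE.PassiveScalarForcedTransportEnergySobolev` (p136128), Rellich on `L²(T²)`
and an Arzelà–Ascoli extraction in `C([0,S]; L²)`; the block architecture (selection, restart, level, weak
limit, endgame) is 0211-c7's, imported by name.  In X's language: an X-witness keeps a positive `limsup`-mean
`L²`-distance from EVERY such comparison family — its leading-order planar flow is enstrophy-unbounded or
`L²`-fast.  Tool stubs (registered; ALL LANDED — p136891 p137431 p137852 p137793 p136503; assembly
`Theorems/TwoAndHalfDTwohalfdThesisSobolevCondensate.lean` p138190 — and wired to the tree theorems below): -/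

/-- **SC-RL `stub_scRellichLp` — Rellich on `L²(T²; ℝ²)` (tool stub).**  The set of `L²` classes with
norm `≤ B` and spectral enstrophy `≤ G` is compact in `L²(T²; ℝ²)` (closed: the norm ball is closed and
`eGradNormSq` is lower semicontinuous on `L²`; totally bounded: low/high Fourier splitting
`‖u − v‖² ≤ ∑_{|k|²≤N} ‖û(k) − v̂(k)‖² + 4G/N` and total boundedness of bounded sets of low modes — the
tree's `EnergySpaceRellich` without the solenoidal/mean-zero restriction).  Leans on:
`Literature.Analysis.FluidPDE.Torus.enorm_sq_le_sum_add_eGradNormSq_div`, `…eGradNormSq_coe_sub_le`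
(FMRT 2001, Ch. I §4 (4.29)). [cite: FMRT2001, Ch. I §4 (4.29)] -/
theorem stub_scRellichLp :
    ∀ (B : ℝ) (G : ℝ≥0),
      IsCompact {w : Lp (EuclideanSpace ℝ (Fin 2)) 2 (volume : Measure (UnitAddTorus (Fin 2))) |
        ‖w‖ ≤ B ∧ Torus.eGradNormSq (w : UnitAddTorus (Fin 2) → EuclideanSpace ℝ (Fin 2)) ≤ G} :=
  Summit.AnomalousDissipation.AnomalousDissipation.Theorems.TwohalfdThesis.SobolevCondensate.stub_scRellichLp

/-- **SC-CMP `stub_scCompactness` — compactness of bounded-enstrophy, `L²`-equi-Lipschitz comparison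
flows (tool stub; replaces 0211-c7's Arzelà–Ascoli RC-AA).**  Continuous comparison flows `W_k` on `ℝ × T²`
with `‖W_k‖ ≤ B`, weakly divergence free at every time, `‖∇W_k(t)‖²_{L²} ≤ G` and
`‖W_k(t) − W_k(s)‖_{L²} ≤ B|t−s|`, GIVEN the compactness of the Rellich set (SC-RL), have a subsequence
converging in `L²((0,S) × T²)` to a jointly measurable `W'` whose slices are, for a.e. `t ∈ (0,S)`, in `L²`
with norm `≤ B`, enstrophy `≤ G` and weakly divergence free (Arzelà–Ascoli in `C([0,S]; L²(T²))` —
`exists_subseq_tendstoUniformlyOn_of_equicontinuous` with values in the compact Rellich set —, completeness of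
`L²((0,S) × T²)` for a measurable representative, `Torus.exists_subseq_tendsto_ae_of_tendsto_lintegral`,
`eGradNormSq_le_of_tendsto_eLpNorm_sub`, `Torus.ae_isWeaklyDivFree_of_tendsto_lintegral`). [folklore] -/
theorem stub_scCompactness :
    ∀ (B S : ℝ) (G : ℝ≥0) (W : ℕ → ℝ → UnitAddTorus (Fin 2) → EuclideanSpace ℝ (Fin 2)), 0 < S →
      IsCompact {w : Lp (EuclideanSpace ℝ (Fin 2)) 2 (volume : Measure (UnitAddTorus (Fin 2))) |
        ‖w‖ ≤ B ∧ Torus.eGradNormSq (w : UnitAddTorus (Fin 2) → EuclideanSpace ℝ (Fin 2)) ≤ G} →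
      (∀ k, Continuous (Function.uncurry (W k))) → (∀ k t x, ‖W k t x‖ ≤ B) →
      (∀ k t, Torus.IsWeaklyDivFree (W k t)) →
      (∀ k t, Torus.eGradNormSq (W k t) ≤ G) →
      (∀ k s t, eLpNorm (W k t - W k s) 2 volume ≤ ENNReal.ofReal (B * |t - s|)) →
      ∃ (φ : ℕ → ℕ) (W' : ℝ → UnitAddTorus (Fin 2) → EuclideanSpace ℝ (Fin 2)), StrictMono φ ∧
        AEStronglyMeasurable (Function.uncurry W')
          (((volume : Measure ℝ).restrict (Set.Ioo 0 S)).prod volume) ∧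
        (∀ᵐ t ∂(volume.restrict (Set.Ioo 0 S)), MemLp (W' t) 2 volume ∧
          eLpNorm (W' t) 2 volume ≤ ENNReal.ofReal B ∧ Torus.eGradNormSq (W' t) ≤ G ∧
          Torus.IsWeaklyDivFree (W' t)) ∧
        Tendsto (fun n => ∫⁻ p, ‖W (φ n) p.1 p.2 - W' p.1 p.2‖ₑ ^ 2
          ∂(((volume : Measure ℝ).restrict (Set.Ioo 0 S)).prod volume)) atTop (𝓝 0) :=
  Summit.AnomalousDissipation.AnomalousDissipation.Theorems.TwohalfdThesis.SobolevCondensate.stub_scCompactness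

/-- **SC-WL2 `stub_scWeakLimitL2` — weak `L²((0,S) × T²)` convergence against ALL of `L²` (tool stub).**
The weak limits of 0211-c7's RC-WL are tested against bounded measurable functions; with the uniform bound
`∫∫ ϑ_k² ≤ C` and `∫∫ Θ² ≤ C` the convergence extends to every `G ∈ L²((0,S) × T²)` (truncate `G` at level
`M`, `‖G − G_M‖_{L²} → 0` by dominated convergence, Cauchy–Schwarz uniformly in `k`, `ε/3`). [folklore] -/
theorem stub_scWeakLimitL2 :
    ∀ (S C : ℝ) (ϑ : ℕ → ℝ → UnitAddTorus (Fin 2) → ℝ) (Θ : ℝ → UnitAddTorus (Fin 2) → ℝ), 0 < S →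
      (∀ k, AEStronglyMeasurable (Function.uncurry (ϑ k))
        (((volume : Measure ℝ).restrict (Set.Ioo 0 S)).prod volume)) →
      (∀ k, Integrable (fun p : ℝ × UnitAddTorus (Fin 2) => ϑ k p.1 p.2 ^ 2)
        (((volume : Measure ℝ).restrict (Set.Ioo 0 S)).prod volume)) →
      (∀ k, ∫ p, ϑ k p.1 p.2 ^ 2 ∂(((volume : Measure ℝ).restrict (Set.Ioo 0 S)).prod volume) ≤ C) →
      AEStronglyMeasurable (Function.uncurry Θ) (((volume : Measure ℝ).restrict (Set.Ioo 0 S)).prod volume) →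
      Integrable (fun p : ℝ × UnitAddTorus (Fin 2) => Θ p.1 p.2 ^ 2)
        (((volume : Measure ℝ).restrict (Set.Ioo 0 S)).prod volume) →
      ∫ p, Θ p.1 p.2 ^ 2 ∂(((volume : Measure ℝ).restrict (Set.Ioo 0 S)).prod volume) ≤ C →
      (∀ G : ℝ × UnitAddTorus (Fin 2) → ℝ,
        AEStronglyMeasurable G (((volume : Measure ℝ).restrict (Set.Ioo 0 S)).prod volume) →
        (∃ M : ℝ, ∀ p, |G p| ≤ M) →
        Tendsto (fun k => ∫ p, ϑ k p.1 p.2 * G p ∂(((volume : Measure ℝ).restrict (Set.Ioo 0 S)).prod volume))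
          atTop (𝓝 (∫ p, Θ p.1 p.2 * G p ∂(((volume : Measure ℝ).restrict (Set.Ioo 0 S)).prod volume)))) →
      ∀ G : ℝ × UnitAddTorus (Fin 2) → ℝ,
        MemLp G 2 (((volume : Measure ℝ).restrict (Set.Ioo 0 S)).prod volume) →
        Tendsto (fun k => ∫ p, ϑ k p.1 p.2 * G p ∂(((volume : Measure ℝ).restrict (Set.Ioo 0 S)).prod volume))
          atTop (𝓝 (∫ p, Θ p.1 p.2 * G p ∂(((volume : Measure ℝ).restrict (Set.Ioo 0 S)).prod volume))) :=
  Summit.AnomalousDissipation.AnomalousDissipation.Theorems.TwohalfdThesis.SobolevCondensate.stub_scWeakLimitL2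

/-- **SC-LIM `stub_scLimit` — the block limit solves the sourced TRANSPORT equation, Sobolev comparison
flows (tool stub; 0211-c7's RC-LIM `stub_rcLimit` with the uniform convergence of bounded continuous `W_k → W'`
replaced by `L²((0,S) × T²)` convergence to a jointly measurable `W'` with `L²` slices of norm `≤ B`, weakly
divergence free for a.e. `t`, and the weak limit tested against `L²` functions, SC-WL2).**  DiPerna–Lions passage
to the limit in the linear transport equation: `ϑ(∂ₜψ + ⟪v,∇ψ⟫ + νΔψ) = ϑG + ϑ⟪v − W',∇ψ⟫ + νϑΔψ` with
`G = ∂ₜψ + ⟪W',∇ψ⟫ ∈ L²((0,S) × T²)`, `‖v_k − W'‖_{L²} ≤ ‖v_k − W_k‖ + ‖W_k − W'‖ → 0`, `ν_k∫∫ϑΔψ → 0`.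
[cite: DiPernaLions1989, §II.1] -/
theorem stub_scLimit :
    ∀ (S : ℝ) (B C C₁ : ℝ) (h : UnitAddTorus (Fin 2) → ℝ) (ν : ℕ → ℝ)
      (v W : ℕ → ℝ → UnitAddTorus (Fin 2) → EuclideanSpace ℝ (Fin 2))
      (W' : ℝ → UnitAddTorus (Fin 2) → EuclideanSpace ℝ (Fin 2))
      (ϑ₀ : ℕ → UnitAddTorus (Fin 2) → ℝ) (ϑ : ℕ → ℝ → UnitAddTorus (Fin 2) → ℝ)
      (Θ₀ : UnitAddTorus (Fin 2) → ℝ) (Θ : ℝ → UnitAddTorus (Fin 2) → ℝ),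
      0 < S → Torus.IsSmooth h → Tendsto ν atTop (𝓝 0) →
      (∀ k, MemLp (ϑ₀ k) 2 volume) →
      (∀ k, Torus.IsWeakScalarTransportForcedOn (S + 1) (ν k) (v k) (fun _ => h) (ϑ₀ k) (ϑ k)) →
      (∀ k, Integrable (fun p : ℝ × UnitAddTorus (Fin 2) => ϑ k p.1 p.2 ^ 2)
        (((volume : Measure ℝ).restrict (Set.Ioo 0 S)).prod volume)) →
      (∀ k, ∫ p, ϑ k p.1 p.2 ^ 2 ∂(((volume : Measure ℝ).restrict (Set.Ioo 0 S)).prod volume) ≤ C) →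
      (∀ k, Continuous (Function.uncurry (W k))) → (∀ k t x, ‖W k t x‖ ≤ B) →
      Tendsto (fun k => ∫⁻ p, ‖v k p.1 p.2 - W k p.1 p.2‖ₑ ^ 2
        ∂(((volume : Measure ℝ).restrict (Set.Ioo 0 S)).prod volume)) atTop (𝓝 0) →
      AEStronglyMeasurable (Function.uncurry W') (((volume : Measure ℝ).restrict (Set.Ioo 0 S)).prod volume) →
      (∀ᵐ t ∂(volume.restrict (Set.Ioo 0 S)), MemLp (W' t) 2 volume ∧
        eLpNorm (W' t) 2 volume ≤ ENNReal.ofReal B ∧ Torus.IsWeaklyDivFree (W' t)) →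
      Tendsto (fun k => ∫⁻ p, ‖W k p.1 p.2 - W' p.1 p.2‖ₑ ^ 2
        ∂(((volume : Measure ℝ).restrict (Set.Ioo 0 S)).prod volume)) atTop (𝓝 0) →
      AEStronglyMeasurable (Function.uncurry Θ) (((volume : Measure ℝ).restrict (Set.Ioo 0 S)).prod volume) →
      Integrable (fun p : ℝ × UnitAddTorus (Fin 2) => Θ p.1 p.2 ^ 2)
        (((volume : Measure ℝ).restrict (Set.Ioo 0 S)).prod volume) →
      (∀ᵐ t ∂(volume.restrict (Set.Ioo 0 S)), ∫ x, Θ t x ^ 2 ≤ C₁) →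
      MemLp Θ₀ 2 volume →
      (∀ G : ℝ × UnitAddTorus (Fin 2) → ℝ,
        MemLp G 2 (((volume : Measure ℝ).restrict (Set.Ioo 0 S)).prod volume) →
        Tendsto (fun k => ∫ p, ϑ k p.1 p.2 * G p ∂(((volume : Measure ℝ).restrict (Set.Ioo 0 S)).prod volume))
          atTop (𝓝 (∫ p, Θ p.1 p.2 * G p ∂(((volume : Measure ℝ).restrict (Set.Ioo 0 S)).prod volume)))) →
      (∀ w : UnitAddTorus (Fin 2) → ℝ, MemLp w 2 volume →
        Tendsto (fun k => ∫ x, ϑ₀ k x * w x) atTop (𝓝 (∫ x, Θ₀ x * w x))) →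
      Torus.IsWeakScalarTransportForcedOn S 0 W' (fun _ => h) Θ₀ Θ :=
  Summit.AnomalousDissipation.AnomalousDissipation.Theorems.TwohalfdThesis.SobolevCondensate.stub_scLimit

/-- **SC-CON `stub_scContradiction` — the block limit cannot live on a long block, Sobolev drift (tool stub;
0211-c7's RC-CON with the Lipschitz energy equality replaced by the landed κ = 0 SOBOLEV balance
`IsWeakScalarTransportForcedOn.integral_sq_eq_of_lintegral_eGradNormSq_rpow_lt_top`, p136128).**  For a weak
solution `Θ ∈ L^∞(0,S;L²)` of `∂ₜΘ + W'·∇Θ = h` with `∫₀^S ‖∇W'(t)‖_{L²} dt < ∞`, `∫∫Θ² ≤ 2ΛS` and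
`∫∫Θh ≥ cS` force `S ≤ 2Λ(c² + 8(∫h²)Λ)/c³` (conservative balance + 0211-c7's ODE endgame `stub_rcEndgame`).
[cite: DiPernaLions1989, §II.3 Thm. II.3] -/
theorem stub_scContradiction :
    ∀ (S c Λ : ℝ) (h : UnitAddTorus (Fin 2) → ℝ)
      (W' : ℝ → UnitAddTorus (Fin 2) → EuclideanSpace ℝ (Fin 2))
      (Θ₀ : UnitAddTorus (Fin 2) → ℝ) (Θ : ℝ → UnitAddTorus (Fin 2) → ℝ),
      0 < S → 0 < c → 0 ≤ Λ → Torus.IsSmooth h → MemLp Θ₀ 2 volume →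
      (∫⁻ t in Set.Ioo 0 S, Torus.eGradNormSq (W' t) ^ (1 / 2 : ℝ) < ⊤) →
      Torus.IsWeakScalarTransportForcedOn S 0 W' (fun _ => h) Θ₀ Θ →
      AEStronglyMeasurable (Function.uncurry Θ) (((volume : Measure ℝ).restrict (Set.Ioo 0 S)).prod volume) →
      Integrable (fun p : ℝ × UnitAddTorus (Fin 2) => Θ p.1 p.2 ^ 2)
        (((volume : Measure ℝ).restrict (Set.Ioo 0 S)).prod volume) →
      ∫ p, Θ p.1 p.2 ^ 2 ∂(((volume : Measure ℝ).restrict (Set.Ioo 0 S)).prod volume) ≤ 2 * Λ * S →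
      c * S ≤ ∫ p, Θ p.1 p.2 * h p.2 ∂(((volume : Measure ℝ).restrict (Set.Ioo 0 S)).prod volume) →
      S ≤ 2 * Λ * (c ^ 2 + 8 * (∫ x, h x ^ 2) * Λ) / c ^ 3 :=
  Summit.AnomalousDissipation.AnomalousDissipation.Theorems.TwohalfdThesis.SobolevCondensate.stub_scContradiction

/-- **SC-CERT `stub_scCertificate` — the SOBOLEV-CONDENSATE no-go (registered tools stub; assembly
`Theorems/TwoAndHalfDTwohalfdThesisSobolevCondensate.lean`).**  Conjunction of the planar theorem
`scalarNoAnomaly_of_sobolevCondensate`, the crux form `twohalfdNeg_family_of_sobolevCondensate` and the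
X-language form `twohalfdThesis_witness_not_sobolevCondensing`: comparison flows continuous, bounded by `B`,
weakly divergence free, enstrophy `≤ G`, `L²`-speed `≤ B`; Sobolev condensation of the planar flow kills the
steady-source scalar anomaly, so an X-witness never condenses onto such a family. [folklore] -/
theorem stub_scCertificate :
    (∀ (g : UnitAddTorus (Fin 2) → EuclideanSpace ℝ (Fin 2)) (h : UnitAddTorus (Fin 2) → ℝ) (B : ℝ) (G : ℝ≥0)
      (W : ℕ → ℝ → UnitAddTorus (Fin 2) → EuclideanSpace ℝ (Fin 2)),
      Torus.IsSmooth g → Torus.HasZeroMean g → Torus.IsSmooth h → Torus.HasZeroMean h →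
      (∀ j, Continuous (Function.uncurry (W j))) → (∀ j t x, ‖W j t x‖ ≤ B) →
      (∀ j t, Torus.IsWeaklyDivFree (W j t)) → (∀ j t, Torus.eGradNormSq (W j t) ≤ G) →
      (∀ j s t, eLpNorm (W j t - W j s) 2 volume ≤ ENNReal.ofReal (B * |t - s|)) →
      ∀ (ν : ℕ → ℝ) (v₀ : ℕ → UnitAddTorus (Fin 2) → EuclideanSpace ℝ (Fin 2))
        (v : ℕ → ℝ → UnitAddTorus (Fin 2) → EuclideanSpace ℝ (Fin 2))
        (θ₀ : ℕ → UnitAddTorus (Fin 2) → ℝ) (θ : ℕ → ℝ → UnitAddTorus (Fin 2) → ℝ),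
        (∀ j, 0 < ν j) → Tendsto ν atTop (𝓝 0) →
        (∀ j, Torus.IsGlobalLerayHopf (ν j) (fun _ => g) (v₀ j) (v j)) →
        Tendsto (fun j => longTimeAvgSup (fun t => ∫ x, ‖v j t x - W j t x‖ ^ 2)) atTop (𝓝 0) →
        (∀ j, MemLp (θ₀ j) 2 volume) →
        (∀ j, Torus.IsWeakScalarTransportForced (ν j) (v j) (fun _ => h) (θ₀ j) (θ j)) →
        (∃ E : ℝ, ∀ j, longTimeAvgSup (fun t => Torus.scalarL2Sq (θ j t)) ≤ E) →
        Tendsto (fun j => longTimeAvgSup (fun t => ν j * (Torus.eScalarGradNormSq (θ j t)).toReal))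
          atTop (𝓝 0)) ∧
    (∀ f : UnitAddTorus (Fin 3) → EuclideanSpace ℝ (Fin 3),
      (∀ (s : UnitAddCircle) (x : UnitAddTorus (Fin 3)), f (x + Pi.single (2 : Fin 3) s) = f x) →
      Torus.IsSmooth f → Torus.IsDivFree f → Torus.HasZeroMean f →
      ∀ (B : ℝ) (G : ℝ≥0) (W : ℕ → ℝ → UnitAddTorus (Fin 2) → EuclideanSpace ℝ (Fin 2)),
        (∀ j, Continuous (Function.uncurry (W j))) → (∀ j t x, ‖W j t x‖ ≤ B) →
        (∀ j t, Torus.IsWeaklyDivFree (W j t)) → (∀ j t, Torus.eGradNormSq (W j t) ≤ G) →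
        (∀ j s t, eLpNorm (W j t - W j s) 2 volume ≤ ENNReal.ofReal (B * |t - s|)) →
      ∀ (ν : ℕ → ℝ) (u₀ : ℕ → UnitAddTorus (Fin 3) → EuclideanSpace ℝ (Fin 3))
        (u : ℕ → ℝ → UnitAddTorus (Fin 3) → EuclideanSpace ℝ (Fin 3)),
        (∀ j, 0 < ν j) → Tendsto ν atTop (𝓝 0) →
        (∀ j, Torus.IsGlobalLerayHopf (ν j) (fun _ => f) (u₀ j) (u j)) →
        (∀ j (t : ℝ) (s : UnitAddCircle) (x : UnitAddTorus (Fin 3)),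
          u j t (x + Pi.single (2 : Fin 3) s) = u j t x) →
        (∃ E : ℝ, ∀ j, meanEnergy (u j) ≤ E) →
        Tendsto (fun j => longTimeAvgSup (fun t =>
          ∫ x, ‖Torus.planarProjE (u j t x) - W j t (Torus.planarProj x)‖ ^ 2)) atTop (𝓝 0) →
        Tendsto (fun j => meanDissipation (ν j) (u j)) atTop (𝓝 0)) ∧
    (∀ f : UnitAddTorus (Fin 3) → EuclideanSpace ℝ (Fin 3),
      (∀ (s : UnitAddCircle) (x : UnitAddTorus (Fin 3)), f (x + Pi.single (2 : Fin 3) s) = f x) →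
      Torus.IsSmooth f → Torus.IsDivFree f → Torus.HasZeroMean f →
      ∀ (B : ℝ) (G : ℝ≥0) (W : ℕ → ℝ → UnitAddTorus (Fin 2) → EuclideanSpace ℝ (Fin 2)),
        (∀ j, Continuous (Function.uncurry (W j))) → (∀ j t x, ‖W j t x‖ ≤ B) →
        (∀ j t, Torus.IsWeaklyDivFree (W j t)) → (∀ j t, Torus.eGradNormSq (W j t) ≤ G) →
        (∀ j s t, eLpNorm (W j t - W j s) 2 volume ≤ ENNReal.ofReal (B * |t - s|)) →
      ∀ (ν : ℕ → ℝ) (u₀ : ℕ → UnitAddTorus (Fin 3) → EuclideanSpace ℝ (Fin 3))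
        (u : ℕ → ℝ → UnitAddTorus (Fin 3) → EuclideanSpace ℝ (Fin 3)),
        (∀ j, 0 < ν j) → Tendsto ν atTop (𝓝 0) →
        (∀ j, Torus.IsGlobalLerayHopf (ν j) (fun _ => f) (u₀ j) (u j)) →
        (∀ j (t : ℝ) (s : UnitAddCircle) (x : UnitAddTorus (Fin 3)),
          u j t (x + Pi.single (2 : Fin 3) s) = u j t x) →
        (∃ E : ℝ, ∀ j, meanEnergy (u j) ≤ E) →
        (∃ ε : ℝ, 0 < ε ∧ ∀ j, ε ≤ meanDissipation (ν j) (u j)) →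
        ¬ Tendsto (fun j => longTimeAvgSup (fun t =>
          ∫ x, ‖Torus.planarProjE (u j t x) - W j t (Torus.planarProj x)‖ ^ 2)) atTop (𝓝 0)) :=
  Summit.AnomalousDissipation.AnomalousDissipation.Theorems.TwohalfdThesis.SobolevCondensate.stub_scCertificate

/-- **SC-LIP `stub_scLipschitzCorollaries` — the Sobolev-condensate theorem CONTAINS both sibling theorems
(tool stub, LANDED p139147).**  (i) An `L`-Lipschitz planar field (sup metric on `T²`) has spectral enstrophy `≤ 2L²`
(translate-modulus `‖W(·+z) − W‖_{L²} ≤ L‖z‖` read on the Fourier side,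
`Torus.lintegral_enorm_sub_translate_sq_eq_tsum`, `|e^{2πik·z} − 1| ~ 2π|k·z|` as `z → 0` along the axes);
(ii) hence 0211-c7's regular-condensate theorem `scalarNoAnomaly_of_regularCondensate` (uniformly `L`-Lipschitz
space–time comparison flows bounded by `L`) is the case `B = L`, `G = 2L²` of `scalarNoAnomaly_of_sobolevCondensate`;
(iii) and 0211-c6's steady Sobolev condensate `scalarNoAnomaly_of_condensate_sobolev` (`V ∈ C⁰ ∩ H¹` weakly
divergence free) is the case `W_j = V`. [folklore] -/
theorem stub_scLipschitzCorollaries :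
    (∀ (L : ℝ≥0) (W : UnitAddTorus (Fin 2) → EuclideanSpace ℝ (Fin 2)), LipschitzWith L W →
      Torus.eGradNormSq W ≤ 2 * (L : ℝ≥0∞) ^ 2) ∧
    (∀ (g : UnitAddTorus (Fin 2) → EuclideanSpace ℝ (Fin 2)) (h : UnitAddTorus (Fin 2) → ℝ) (L : ℝ≥0)
      (W : ℕ → ℝ → UnitAddTorus (Fin 2) → EuclideanSpace ℝ (Fin 2)),
      Torus.IsSmooth g → Torus.HasZeroMean g → Torus.IsSmooth h → Torus.HasZeroMean h →
      (∀ j, LipschitzWith L (Function.uncurry (W j))) → (∀ j t x, ‖W j t x‖ ≤ L) →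
      (∀ j t, Torus.IsWeaklyDivFree (W j t)) →
      ∀ (ν : ℕ → ℝ) (v₀ : ℕ → UnitAddTorus (Fin 2) → EuclideanSpace ℝ (Fin 2))
        (v : ℕ → ℝ → UnitAddTorus (Fin 2) → EuclideanSpace ℝ (Fin 2))
        (θ₀ : ℕ → UnitAddTorus (Fin 2) → ℝ) (θ : ℕ → ℝ → UnitAddTorus (Fin 2) → ℝ),
        (∀ j, 0 < ν j) → Tendsto ν atTop (𝓝 0) →
        (∀ j, Torus.IsGlobalLerayHopf (ν j) (fun _ => g) (v₀ j) (v j)) →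
        Tendsto (fun j => longTimeAvgSup (fun t => ∫ x, ‖v j t x - W j t x‖ ^ 2)) atTop (𝓝 0) →
        (∀ j, MemLp (θ₀ j) 2 volume) →
        (∀ j, Torus.IsWeakScalarTransportForced (ν j) (v j) (fun _ => h) (θ₀ j) (θ j)) →
        (∃ E : ℝ, ∀ j, longTimeAvgSup (fun t => Torus.scalarL2Sq (θ j t)) ≤ E) →
        Tendsto (fun j => longTimeAvgSup (fun t => ν j * (Torus.eScalarGradNormSq (θ j t)).toReal))
          atTop (𝓝 0)) ∧
    (∀ (g : UnitAddTorus (Fin 2) → EuclideanSpace ℝ (Fin 2)) (h : UnitAddTorus (Fin 2) → ℝ)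
      (V : UnitAddTorus (Fin 2) → EuclideanSpace ℝ (Fin 2)),
      Torus.IsSmooth g → Torus.HasZeroMean g → Torus.IsSmooth h → Torus.HasZeroMean h →
      Continuous V → Torus.IsWeaklyDivFree V → Torus.eGradNormSq V < ⊤ →
      ∀ (ν : ℕ → ℝ) (v₀ : ℕ → UnitAddTorus (Fin 2) → EuclideanSpace ℝ (Fin 2))
        (v : ℕ → ℝ → UnitAddTorus (Fin 2) → EuclideanSpace ℝ (Fin 2))
        (θ₀ : ℕ → UnitAddTorus (Fin 2) → ℝ) (θ : ℕ → ℝ → UnitAddTorus (Fin 2) → ℝ),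
        (∀ j, 0 < ν j) → Tendsto ν atTop (𝓝 0) →
        (∀ j, Torus.IsGlobalLerayHopf (ν j) (fun _ => g) (v₀ j) (v j)) →
        Tendsto (fun j => longTimeAvgSup (fun t => ∫ x, ‖v j t x - V x‖ ^ 2)) atTop (𝓝 0) →
        (∀ j, MemLp (θ₀ j) 2 volume) →
        (∀ j, Torus.IsWeakScalarTransportForced (ν j) (v j) (fun _ => h) (θ₀ j) (θ j)) →
        (∃ E : ℝ, ∀ j, longTimeAvgSup (fun t => Torus.scalarL2Sq (θ j t)) ≤ E) →
        Tendsto (fun j => longTimeAvgSup (fun t => ν j * (Torus.eScalarGradNormSq (θ j t)).toReal))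
          atTop (𝓝 0)) :=
  Summit.AnomalousDissipation.AnomalousDissipation.Theorems.TwohalfdThesis.SobolevCondensate.stub_scLipschitzCorollaries

/-- **SC-FAR `stub_scWitnessFar` — an X-witness is EVENTUALLY `L²`-far from every Sobolev comparison family
(tool stub, LANDED p138902; quantitative form of `twohalfdThesis_witness_not_sobolevCondensing`).**  Under the hypotheses of the
X-language no-go, not only does the `limsup`-mean fluctuation `⟨∫‖π_E u_j − W_j ∘ π‖²⟩` fail to tend to `0`: it is
bounded BELOW by some `δ > 0` for all large `j` (apply the no-go to every subsequence — a subsequence of an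
X-witness is an X-witness; `Filter.extraction_forall_of_frequently`). [folklore] -/
theorem stub_scWitnessFar :
    ∀ f : UnitAddTorus (Fin 3) → EuclideanSpace ℝ (Fin 3),
      (∀ (s : UnitAddCircle) (x : UnitAddTorus (Fin 3)), f (x + Pi.single (2 : Fin 3) s) = f x) →
      Torus.IsSmooth f → Torus.IsDivFree f → Torus.HasZeroMean f →
      ∀ (B : ℝ) (G : ℝ≥0) (W : ℕ → ℝ → UnitAddTorus (Fin 2) → EuclideanSpace ℝ (Fin 2)),
        (∀ j, Continuous (Function.uncurry (W j))) → (∀ j t x, ‖W j t x‖ ≤ B) →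
        (∀ j t, Torus.IsWeaklyDivFree (W j t)) → (∀ j t, Torus.eGradNormSq (W j t) ≤ G) →
        (∀ j s t, eLpNorm (W j t - W j s) 2 volume ≤ ENNReal.ofReal (B * |t - s|)) →
      ∀ (ν : ℕ → ℝ) (u₀ : ℕ → UnitAddTorus (Fin 3) → EuclideanSpace ℝ (Fin 3))
        (u : ℕ → ℝ → UnitAddTorus (Fin 3) → EuclideanSpace ℝ (Fin 3)),
        (∀ j, 0 < ν j) → Tendsto ν atTop (𝓝 0) →
        (∀ j, Torus.IsGlobalLerayHopf (ν j) (fun _ => f) (u₀ j) (u j)) →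
        (∀ j (t : ℝ) (s : UnitAddCircle) (x : UnitAddTorus (Fin 3)),
          u j t (x + Pi.single (2 : Fin 3) s) = u j t x) →
        (∃ E : ℝ, ∀ j, meanEnergy (u j) ≤ E) →
        (∃ ε : ℝ, 0 < ε ∧ ∀ j, ε ≤ meanDissipation (ν j) (u j)) →
        ∃ δ : ℝ, 0 < δ ∧ ∀ᶠ j in atTop, δ ≤ longTimeAvgSup (fun t =>
          ∫ x, ‖Torus.planarProjE (u j t x) - W j t (Torus.planarProj x)‖ ^ 2) :=
  Summit.AnomalousDissipation.AnomalousDissipation.Theorems.TwohalfdThesis.SobolevCondensate.stub_scWitnessFar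

/-! ## O — THE WITNESS WINDOW: planar strain `≳ log`, enstrophy in `[c·log², C·ν^{-1/2}]`, in X's language (lead c8, 2026-08-17)

Registered tool stubs of lead c8.  The strain gate G and 0211's sub-log certificates speak about W-members or
about 2-D families; in X's OWN `∃`-language the tree had only the non-quantitative, full-gradient form
`¬(⟨‖∇u_j‖₂⟩/log(1/ν_j) → 0)` (`SubLogFamily.stub_subLogFamily`).  Section O states the necessary structure of
an X-witness on its PLANAR SECTION `v_j = π_E ∘ u_j ∘ ι` and with an EVENTUAL RATE (X-witnesses are stable under
subsequences, so "not `→ 0`" upgrades to "`≥ c·log` for all large `j`"): O1 planar sub-log no-go, O2 eventual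
log strain, O3 Jensen for honest `limsup` means, O4 the Alexakis–Doering enstrophy ceiling `ν^{-1/2}`, O-CERT the
window.  All hypotheses of X verbatim; `ν_j → 0` is used (O1 via the 0211 engines, O2 via `log(1/ν_j) → ∞`). -/

/-- **O1 `stub_planarSubLogNoGo` (M; the lead's) — the PLANAR sub-log-strain no-go in X's own language.**  For every
X-witness `(f, ν, u₀, u)` (all hypotheses of `TwohalfdThesis` verbatim) the `limsup`-mean STRAIN of the PLANAR SECTION
`v_j(t) = π_E ∘ u_j(t) ∘ ι` (`ι = Torus.planarSect`, `π_E = Torus.planarProjE`) is not sub-logarithmic: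
`¬ (⟨‖∇v_j‖₂⟩ / log(1/ν_j) → 0)`.  The tree has this only with the FULL gradient `‖∇u_j‖₂` (0211's
`SubLogFamily.not_subLogStrain_of_dissipationFloor`), a hypothesis dominated by the scalar gradient
`‖∇w_j‖₂ ~ (ε/ν_j)^{1/2}`; the planar form is the informative one (Alexakis–Doering: `ν_j⟨‖∇v_j‖²⟩ → 0`).
PROOF ROUTE: `ReductionOffZero.stub_reductionOffZero` (sections `g,h,v_j,θ_j`, `u_j(t) = twoHalf (v_j t) (θ_j t)` for
`t ≠ 0`, `v_j` global Leray–Hopf for `g`, bounded mean energy / variance, dissipation sub-splitting);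
`planarProjE_twoHalf_planarSect` + `longTimeAvgSup_congr_of_eqOn_Ioi` identify the section's strain with `v_j`'s;
`PlanarNoAnomaly.stub_planarNoAnomaly` (planar dissipation `→ 0`) and the per-family engine
`PerForceCertificate.scalarNoAnomaly_of_subLogStrain_family` (sub-log strain ⇒ scalar dissipation `→ 0`);
squeeze against the floor `ε`.  Leans on: landed 0211 files only; nothing unproved. [folklore] -/
theorem stub_planarSubLogNoGo :
    ∀ f : UnitAddTorus (Fin 3) → EuclideanSpace ℝ (Fin 3),
      (∀ (s : UnitAddCircle) (x : UnitAddTorus (Fin 3)), f (x + Pi.single (2 : Fin 3) s) = f x) →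
      Torus.IsSmooth f → Torus.IsDivFree f → Torus.HasZeroMean f →
      ∀ (ν : ℕ → ℝ) (u₀ : ℕ → UnitAddTorus (Fin 3) → EuclideanSpace ℝ (Fin 3))
        (u : ℕ → ℝ → UnitAddTorus (Fin 3) → EuclideanSpace ℝ (Fin 3)),
        (∀ j, 0 < ν j) → Tendsto ν atTop (𝓝 0) →
        (∀ j, Torus.IsGlobalLerayHopf (ν j) (fun _ => f) (u₀ j) (u j)) →
        (∀ j (t : ℝ) (s : UnitAddCircle) (x : UnitAddTorus (Fin 3)),
          u j t (x + Pi.single (2 : Fin 3) s) = u j t x) →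
        (∃ E : ℝ, ∀ j, meanEnergy (u j) ≤ E) →
        (∃ ε : ℝ, 0 < ε ∧ ∀ j, ε ≤ meanDissipation (ν j) (u j)) →
        ¬ Tendsto (fun j => longTimeAvgSup (fun t => Real.sqrt (Torus.eGradNormSq
            (fun y : UnitAddTorus (Fin 2) => Torus.planarProjE (u j t (Torus.planarSect y)))).toReal) /
          Real.log (ν j)⁻¹) atTop (𝓝 0) :=
  Summit.AnomalousDissipation.AnomalousDissipation.Theorems.TwohalfdThesis.stub_planarSubLogNoGo

/-- **O2 `stub_eventualLogStrain` (S/M; wave) — from "not sub-log" to an EVENTUAL LOGARITHMIC RATE.**  `(O1, verbatim,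
as a hypothesis) →` for every X-witness there is `c > 0` with `c·log(1/ν_j) ≤ ⟨‖∇v_j‖₂⟩` for all large `j`
(`liminf_j ⟨‖∇v_j‖₂⟩/log(1/ν_j) > 0`, strictly stronger than O1's `limsup_j > 0`).  PROOF ROUTE: by contradiction,
for every `n` frequently in `j`: `⟨‖∇v_j‖₂⟩ < log(1/ν_j)/(n+1)` (and `ν_j < 1`); `Filter.extraction_forall_of_frequently`
gives a strictly monotone `φ` along which the ratio tends to `0` (squeeze, ratio `≥ 0` once `ν < 1`:
`longTimeAvgSup_nonneg`, `Real.log_nonneg`); the subsequence `(ν ∘ φ, u₀ ∘ φ, u ∘ φ)` is again an X-witness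
(`hν0.comp hφ.tendsto_atTop`, the other clauses are pointwise in `j`) — contradiction with O1.  Leans on: Mathlib
`Filter` API only. [folklore] -/
theorem stub_eventualLogStrain :
    (∀ f : UnitAddTorus (Fin 3) → EuclideanSpace ℝ (Fin 3),
      (∀ (s : UnitAddCircle) (x : UnitAddTorus (Fin 3)), f (x + Pi.single (2 : Fin 3) s) = f x) →
      Torus.IsSmooth f → Torus.IsDivFree f → Torus.HasZeroMean f →
      ∀ (ν : ℕ → ℝ) (u₀ : ℕ → UnitAddTorus (Fin 3) → EuclideanSpace ℝ (Fin 3))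
        (u : ℕ → ℝ → UnitAddTorus (Fin 3) → EuclideanSpace ℝ (Fin 3)),
        (∀ j, 0 < ν j) → Tendsto ν atTop (𝓝 0) →
        (∀ j, Torus.IsGlobalLerayHopf (ν j) (fun _ => f) (u₀ j) (u j)) →
        (∀ j (t : ℝ) (s : UnitAddCircle) (x : UnitAddTorus (Fin 3)),
          u j t (x + Pi.single (2 : Fin 3) s) = u j t x) →
        (∃ E : ℝ, ∀ j, meanEnergy (u j) ≤ E) →
        (∃ ε : ℝ, 0 < ε ∧ ∀ j, ε ≤ meanDissipation (ν j) (u j)) →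
        ¬ Tendsto (fun j => longTimeAvgSup (fun t => Real.sqrt (Torus.eGradNormSq
            (fun y : UnitAddTorus (Fin 2) => Torus.planarProjE (u j t (Torus.planarSect y)))).toReal) /
          Real.log (ν j)⁻¹) atTop (𝓝 0)) →
    ∀ f : UnitAddTorus (Fin 3) → EuclideanSpace ℝ (Fin 3),
      (∀ (s : UnitAddCircle) (x : UnitAddTorus (Fin 3)), f (x + Pi.single (2 : Fin 3) s) = f x) →
      Torus.IsSmooth f → Torus.IsDivFree f → Torus.HasZeroMean f →
      ∀ (ν : ℕ → ℝ) (u₀ : ℕ → UnitAddTorus (Fin 3) → EuclideanSpace ℝ (Fin 3))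
        (u : ℕ → ℝ → UnitAddTorus (Fin 3) → EuclideanSpace ℝ (Fin 3)),
        (∀ j, 0 < ν j) → Tendsto ν atTop (𝓝 0) →
        (∀ j, Torus.IsGlobalLerayHopf (ν j) (fun _ => f) (u₀ j) (u j)) →
        (∀ j (t : ℝ) (s : UnitAddCircle) (x : UnitAddTorus (Fin 3)),
          u j t (x + Pi.single (2 : Fin 3) s) = u j t x) →
        (∃ E : ℝ, ∀ j, meanEnergy (u j) ≤ E) →
        (∃ ε : ℝ, 0 < ε ∧ ∀ j, ε ≤ meanDissipation (ν j) (u j)) →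
        ∃ c : ℝ, 0 < c ∧ ∀ᶠ j in atTop, c * Real.log (ν j)⁻¹ ≤
          longTimeAvgSup (fun t => Real.sqrt (Torus.eGradNormSq
            (fun y : UnitAddTorus (Fin 2) => Torus.planarProjE (u j t (Torus.planarSect y)))).toReal) :=
  Summit.AnomalousDissipation.AnomalousDissipation.Theorems.TwohalfdThesis.stub_eventualLogStrain

/-- **O3 `stub_strainSqLeEnstrophy` (S/M; wave) — Jensen for the honest `limsup` means.**  Along ONE global Leray–Hopf
solution `v` of the planar Navier–Stokes system with steady force `g ∈ L²`, `∫ g = 0`, `ν > 0`: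
`⟨‖∇v‖₂⟩² ≤ ⟨‖∇v‖₂²⟩` (`⟨·⟩ = longTimeAvgSup = limsup` of running means).  PROOF ROUTE: for `T > 0`,
`timeMean √Z T ≤ √(timeMean Z T)` (`timeMean_sqrt_le_sqrt_timeMean`; `Z = (eGradNormSq (v ·)).toReal` is integrable
on `(0,T)`: `integrable_toReal_of_lintegral_ne_top` with `(hLH T hT).lintegral_eGradNormSq_lt_top`, cf. the proof of
`sq_le_longTimeAvgSup_eGradNormSq_of_le_longTimeAvgInf` in `…StrainGateEnstrophy.lean`); the running means of `Z` are
bounded (`isBoundedUnder_timeMean_eGradNormSq`), so for every `η > 0` frequently `timeMean Z T ≥ (S − η)²` where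
`S = ⟨√Z⟩` (if `S ≤ 0` the claim is `longTimeAvgSup_nonneg`), whence `le_limsup_of_frequently_le`; let `η → 0`.
Leans on: `TwoAndHalfDTwohalfdThesisStrainGateEnstrophy` lemmas, `TwohalfdNeg.QuietOfSubLog`
(`isBoundedUnder_timeMean_sqrt_eGradNormSq`); nothing unproved. [folklore] -/
theorem stub_strainSqLeEnstrophy :
    ∀ (ν : ℝ) (g : UnitAddTorus (Fin 2) → EuclideanSpace ℝ (Fin 2))
      (v₀ : UnitAddTorus (Fin 2) → EuclideanSpace ℝ (Fin 2))
      (v : ℝ → UnitAddTorus (Fin 2) → EuclideanSpace ℝ (Fin 2)),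
      0 < ν → MemLp g 2 volume → Torus.HasZeroMean g →
      Torus.IsGlobalLerayHopf ν (fun _ => g) v₀ v →
      (longTimeAvgSup (fun t => Real.sqrt (Torus.eGradNormSq (v t)).toReal)) ^ 2 ≤
        longTimeAvgSup (fun t => (Torus.eGradNormSq (v t)).toReal) :=
  Summit.AnomalousDissipation.AnomalousDissipation.Theorems.TwohalfdThesis.stub_strainSqLeEnstrophy

/-- **O4 `stub_planarEnstrophyCeiling` (S; wave) — the rigorous CEILING in the same currency (Alexakis–Doering).**
Along ONE global Leray–Hopf solution `v` of planar NS with smooth steady mean-zero `g`, `‖Δg‖ ≤ K`, `ν > 0` and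
`⟨‖v‖₂²⟩ ≤ E`: `⟨‖∇v‖₂²⟩ ≤ (K E^{3/2}/ν)^{1/2}`.  PROOF ROUTE: `meanDissipation ν v ≤ √(ν K (√E·E))`
(`Literature.Barriers.AnomalousDissipation.meanDissipation_le_sqrt_of_L2`), `meanDissipation ν v = ν·⟨‖∇v‖₂²⟩`
(`longTimeAvgSup_const_mul`, unfold `meanDissipation`), divide by `ν` (`Real.sqrt` algebra: `√(νx)/ν = √(x/ν)`).
Leans on: `TwoDimensionalEnergyDissipationL2Data`, `ZerothLawProofs`; nothing unproved. [cite: AlexakisDoering2006PLA, §2] -/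
theorem stub_planarEnstrophyCeiling :
    ∀ (ν K E : ℝ) (g : UnitAddTorus (Fin 2) → EuclideanSpace ℝ (Fin 2))
      (v₀ : UnitAddTorus (Fin 2) → EuclideanSpace ℝ (Fin 2))
      (v : ℝ → UnitAddTorus (Fin 2) → EuclideanSpace ℝ (Fin 2)),
      0 < ν → Torus.IsSmooth g → Torus.HasZeroMean g → 0 ≤ K →
      (∀ x, ‖Torus.laplacian g x‖ ≤ K) →
      Torus.IsGlobalLerayHopf ν (fun _ => g) v₀ v → meanEnergy v ≤ E →
      longTimeAvgSup (fun t => (Torus.eGradNormSq (v t)).toReal) ≤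
        Real.sqrt (K * (Real.sqrt E * E) / ν) :=
  Summit.AnomalousDissipation.AnomalousDissipation.Theorems.TwohalfdThesis.stub_planarEnstrophyCeiling

/-- **O-CERT `stub_witnessWindow` (assembly; the lead's) — THE WITNESS WINDOW in X's language.**  Every X-witness
`(f, ν, u₀, u)` has, for its planar section `v_j = π_E ∘ u_j ∘ ι`: (i) `c·log(1/ν_j) ≤ ⟨‖∇v_j‖₂⟩` eventually,
(ii) `c·log²(1/ν_j) ≤ ⟨‖∇v_j‖₂²⟩` eventually, (iii) `⟨‖∇v_j‖₂²⟩ ≤ C ν_j^{-1/2}` for all `j` — the planar flow of a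
witness lives in the enstrophy window `[c log²(1/ν), C ν^{-1/2}]` (needed vs allowed; cascade phenomenology puts the
natural attractor at `log^{2/3}`, below the window).  PROOF ROUTE: O1 + O2 for (i); reduction + O3 for (ii)
(`c² log² ≤ ⟨‖∇v_j‖₂⟩² ≤ ⟨‖∇v_j‖₂²⟩` once `log ≥ 0`); reduction + O4 with `K = sup‖Δg‖`, `E` the planar energy
bound, `C = √(K√E·E)` for (iii).  Leans on: O1–O4. [folklore] -/
theorem stub_witnessWindow :
    ∀ f : UnitAddTorus (Fin 3) → EuclideanSpace ℝ (Fin 3),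
      (∀ (s : UnitAddCircle) (x : UnitAddTorus (Fin 3)), f (x + Pi.single (2 : Fin 3) s) = f x) →
      Torus.IsSmooth f → Torus.IsDivFree f → Torus.HasZeroMean f →
      ∀ (ν : ℕ → ℝ) (u₀ : ℕ → UnitAddTorus (Fin 3) → EuclideanSpace ℝ (Fin 3))
        (u : ℕ → ℝ → UnitAddTorus (Fin 3) → EuclideanSpace ℝ (Fin 3)),
        (∀ j, 0 < ν j) → Tendsto ν atTop (𝓝 0) →
        (∀ j, Torus.IsGlobalLerayHopf (ν j) (fun _ => f) (u₀ j) (u j)) →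
        (∀ j (t : ℝ) (s : UnitAddCircle) (x : UnitAddTorus (Fin 3)),
          u j t (x + Pi.single (2 : Fin 3) s) = u j t x) →
        (∃ E : ℝ, ∀ j, meanEnergy (u j) ≤ E) →
        (∃ ε : ℝ, 0 < ε ∧ ∀ j, ε ≤ meanDissipation (ν j) (u j)) →
        (∃ c : ℝ, 0 < c ∧ ∀ᶠ j in atTop, c * Real.log (ν j)⁻¹ ≤
          longTimeAvgSup (fun t => Real.sqrt (Torus.eGradNormSq
            (fun y : UnitAddTorus (Fin 2) => Torus.planarProjE (u j t (Torus.planarSect y)))).toReal)) ∧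
        (∃ c : ℝ, 0 < c ∧ ∀ᶠ j in atTop, c * (Real.log (ν j)⁻¹) ^ 2 ≤
          longTimeAvgSup (fun t => (Torus.eGradNormSq
            (fun y : UnitAddTorus (Fin 2) => Torus.planarProjE (u j t (Torus.planarSect y)))).toReal)) ∧
        (∃ C : ℝ, 0 ≤ C ∧ ∀ j, longTimeAvgSup (fun t => (Torus.eGradNormSq
            (fun y : UnitAddTorus (Fin 2) => Torus.planarProjE (u j t (Torus.planarSect y)))).toReal) ≤
          C * Real.sqrt (ν j)⁻¹) :=
  Summit.AnomalousDissipation.AnomalousDissipation.Theorems.TwohalfdThesis.stub_witnessWindow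

/-! ## P — UNIFORMITY: the witness window's floor constant depends only on the force and the budget (lead c8, 2026-08-17)

Section O gave each X-witness its own floor constant `c`.  A diagonal extraction over bad families (O1 applied to the
diagonal family, which is again an X-witness for the same `f`) swaps the quantifiers: `c = c(f, E, ε)` serves every
vanishing-viscosity family of `x₃`-invariant global Leray–Hopf solutions forced by `f` with `meanEnergy ≤ E` and
`meanDissipation ≥ ε` (the threshold in `j` stays family-dependent).  Consequently the `log²` enstrophy floor of O-CERT (ii)
holds with the uniform constant `c²` as well. -/

/-- **P1 `stub_uniformLogStrain` (S; the lead's, LANDED p141462 `Theorems/TwoAndHalfDTwohalfdThesisStubUniformLogStrain.lean`) —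
the logarithmic strain floor is UNIFORM over witness families.**  `(O1 verbatim as hypothesis) →` for every admissible `f`,
every `E` and every `ε > 0` there is `c > 0` such that every family `(ν, u₀, u)` as in X with energy level `E` and floor `ε`
has `c·log(1/ν_j) ≤ ⟨‖∇v_j‖₂⟩` eventually.  PROOF ROUTE: by contradiction choose for each `n` a bad family at constant
`1/(n+1)` and in it an index `J n` with `ν < 1/(n+1)`, `log(1/ν) > 0`, ratio `< 1/(n+1)`; the diagonal family is an
X-witness with vanishing ratio, contradicting O1.  Leans on: Mathlib `Filter` API, `longTimeAvgSup_nonneg`. [folklore] -/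
theorem stub_uniformLogStrain :
    (∀ f : UnitAddTorus (Fin 3) → EuclideanSpace ℝ (Fin 3),
      (∀ (s : UnitAddCircle) (x : UnitAddTorus (Fin 3)), f (x + Pi.single (2 : Fin 3) s) = f x) →
      Torus.IsSmooth f → Torus.IsDivFree f → Torus.HasZeroMean f →
      ∀ (ν : ℕ → ℝ) (u₀ : ℕ → UnitAddTorus (Fin 3) → EuclideanSpace ℝ (Fin 3))
        (u : ℕ → ℝ → UnitAddTorus (Fin 3) → EuclideanSpace ℝ (Fin 3)),
        (∀ j, 0 < ν j) → Tendsto ν atTop (𝓝 0) →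
        (∀ j, Torus.IsGlobalLerayHopf (ν j) (fun _ => f) (u₀ j) (u j)) →
        (∀ j (t : ℝ) (s : UnitAddCircle) (x : UnitAddTorus (Fin 3)),
          u j t (x + Pi.single (2 : Fin 3) s) = u j t x) →
        (∃ E : ℝ, ∀ j, meanEnergy (u j) ≤ E) →
        (∃ ε : ℝ, 0 < ε ∧ ∀ j, ε ≤ meanDissipation (ν j) (u j)) →
        ¬ Tendsto (fun j => longTimeAvgSup (fun t => Real.sqrt (Torus.eGradNormSq
            (fun y : UnitAddTorus (Fin 2) => Torus.planarProjE (u j t (Torus.planarSect y)))).toReal) /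
          Real.log (ν j)⁻¹) atTop (𝓝 0)) →
    ∀ f : UnitAddTorus (Fin 3) → EuclideanSpace ℝ (Fin 3),
      (∀ (s : UnitAddCircle) (x : UnitAddTorus (Fin 3)), f (x + Pi.single (2 : Fin 3) s) = f x) →
      Torus.IsSmooth f → Torus.IsDivFree f → Torus.HasZeroMean f →
      ∀ (E ε : ℝ), 0 < ε →
        ∃ c : ℝ, 0 < c ∧
          ∀ (ν : ℕ → ℝ) (u₀ : ℕ → UnitAddTorus (Fin 3) → EuclideanSpace ℝ (Fin 3))
            (u : ℕ → ℝ → UnitAddTorus (Fin 3) → EuclideanSpace ℝ (Fin 3)),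
            (∀ j, 0 < ν j) → Tendsto ν atTop (𝓝 0) →
            (∀ j, Torus.IsGlobalLerayHopf (ν j) (fun _ => f) (u₀ j) (u j)) →
            (∀ j (t : ℝ) (s : UnitAddCircle) (x : UnitAddTorus (Fin 3)),
              u j t (x + Pi.single (2 : Fin 3) s) = u j t x) →
            (∀ j, meanEnergy (u j) ≤ E) → (∀ j, ε ≤ meanDissipation (ν j) (u j)) →
            ∀ᶠ j in atTop, c * Real.log (ν j)⁻¹ ≤
              longTimeAvgSup (fun t => Real.sqrt (Torus.eGradNormSq
                (fun y : UnitAddTorus (Fin 2) => Torus.planarProjE (u j t (Torus.planarSect y)))).toReal) :=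
  Summit.AnomalousDissipation.AnomalousDissipation.Theorems.TwohalfdThesis.stub_uniformLogStrain

/-- **P-CERT `stub_uniformWindow` (assembly; the lead's) — THE WITNESS WINDOW WITH UNIFORM CONSTANTS.**  For every
admissible `f`, every `E` and every `ε > 0` there are `c = c(f,E,ε) > 0` and `C = C(f,E) ≥ 0` such that EVERY family
`(ν, u₀, u)` as in X with energy level `E` and floor `ε` has, for its planar section `v_j`: (i) `c·log(1/ν_j) ≤ ⟨‖∇v_j‖₂⟩`
eventually, (ii) `c²·log²(1/ν_j) ≤ ⟨‖∇v_j‖₂²⟩` eventually, (iii) `⟨‖∇v_j‖₂²⟩ ≤ C·ν_j^{-1/2}` for all `j`.  PROOF ROUTE: P1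
(with O1) for `c`; reduction (its planar force is `π_E ∘ f ∘ ι` itself, `twoHalf_left_injective`), O3 for (ii), O4 with
`K = sup‖Δ(π_E ∘ f ∘ ι)‖` and planar energy `≤ meanEnergy u_j ≤ E` (`ReductionOffZero.meanEnergy_planar_le`) for (iii).
Leans on: O1, O3, O4, P1. [folklore] -/
theorem stub_uniformWindow :
    ∀ f : UnitAddTorus (Fin 3) → EuclideanSpace ℝ (Fin 3),
      (∀ (s : UnitAddCircle) (x : UnitAddTorus (Fin 3)), f (x + Pi.single (2 : Fin 3) s) = f x) →
      Torus.IsSmooth f → Torus.IsDivFree f → Torus.HasZeroMean f →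
      ∀ (E ε : ℝ), 0 < ε →
        ∃ c C : ℝ, 0 < c ∧ 0 ≤ C ∧
          ∀ (ν : ℕ → ℝ) (u₀ : ℕ → UnitAddTorus (Fin 3) → EuclideanSpace ℝ (Fin 3))
            (u : ℕ → ℝ → UnitAddTorus (Fin 3) → EuclideanSpace ℝ (Fin 3)),
            (∀ j, 0 < ν j) → Tendsto ν atTop (𝓝 0) →
            (∀ j, Torus.IsGlobalLerayHopf (ν j) (fun _ => f) (u₀ j) (u j)) →
            (∀ j (t : ℝ) (s : UnitAddCircle) (x : UnitAddTorus (Fin 3)),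
              u j t (x + Pi.single (2 : Fin 3) s) = u j t x) →
            (∀ j, meanEnergy (u j) ≤ E) → (∀ j, ε ≤ meanDissipation (ν j) (u j)) →
            (∀ᶠ j in atTop, c * Real.log (ν j)⁻¹ ≤
              longTimeAvgSup (fun t => Real.sqrt (Torus.eGradNormSq
                (fun y : UnitAddTorus (Fin 2) => Torus.planarProjE (u j t (Torus.planarSect y)))).toReal)) ∧
            (∀ᶠ j in atTop, c ^ 2 * (Real.log (ν j)⁻¹) ^ 2 ≤
              longTimeAvgSup (fun t => (Torus.eGradNormSq
                (fun y : UnitAddTorus (Fin 2) => Torus.planarProjE (u j t (Torus.planarSect y)))).toReal)) ∧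
            (∀ j, longTimeAvgSup (fun t => (Torus.eGradNormSq
                (fun y : UnitAddTorus (Fin 2) => Torus.planarProjE (u j t (Torus.planarSect y)))).toReal) ≤
              C * Real.sqrt (ν j)⁻¹) :=
  Summit.AnomalousDissipation.AnomalousDissipation.Theorems.TwohalfdThesis.stub_uniformWindow

/-! ## Q — SELECTIVITY OF THE WITNESS'S MIXING: the vorticity twin and the non-selective no-go (lead c9, 2026-08-17)

Registered tool stubs (this cycle's wave).  Prandtl number one: the planar vorticity `ω_j = curl v_j` of a W-member solves
the crux's OWN scalar equation over the same drift with the same diffusivity `ν_j`, sourced by the torque pattern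
`curl g` (Q1).  Duhamel with datum (Q2): a classical steadily sourced scalar whose releases (from every late time) obey ONE
integrable `L²` envelope has `limsup`-mean variance `≤ M²‖source‖²`, whatever its (mean-zero) datum — the datum's own
release dies at fixed `κ > 0` (`stub_fixedViscosityEnvelope`), the sourced remainder is D0 + D1 after a time shift.  With
`‖∇v‖₂² = ‖curl v‖₂²` (Q3) a uniform envelope for the releases of `curl g` therefore caps the mean ENSTROPHY of every
member by `M'²‖curl g‖²` uniformly in `j` (Q4), while the strain gate (G5, template G4) forces mean enstrophy
`≳ log²(1/ν_j)` along every W-family: Q5 — the body of W together with a `j`-uniform integrable envelope for the torque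
pattern is contradictory.  Reading (ideators' W10, `NonselectiveNoGo`, now a theorem at W's classical level): an
X-witness flow is a SELECTIVE enhancer — it relaxes `h` in `O(1)` time uniformly in `ν` but must keep its own torque
pattern correlated for `≳ log(1/ν_j)`; every pattern-blind mixing mechanism is excluded, and `h ∈ ℝ·curl g` is excluded
at W-level (corollaries in Q5's file).  The curl is written inline, `fun x => ∂₀w x 1 - ∂₁w x 0`
(`Torus.partialDeriv`), as in 0211's `VorticityTransport`. -/

/-- **Q1 `stub_vorticityEquation` (M; wave) — LANDED p143927 (`Theorems/TwoAndHalfDTwohalfdThesisStubVorticityEquation.lean`) — THE TWIN: classical planar vorticity equation.**  For a classical solution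
`(v, p)` of the planar Navier–Stokes system on `[0, ∞) × T²` with steady smooth force `g` (any `ν`), the scalar vorticity
`ω(t) = ∂₀v₁(t) − ∂₁v₀(t)` is a classical solution of the SOURCED scalar equation `∂ₜω + v·∇ω = νΔω + curl g` on
`[0, ∞)` over the same drift with the same diffusivity.  PROOF ROUTE (pointwise calculus on smooth slices): apply `∂₀` to
the second and `∂₁` to the first component of the momentum equation and subtract; `∂ₜ` commutes with `∂ⱼ`
(`Torus.timeDerivWithin_partialDeriv_comm` on windows `Icc 0 T` + `IsSmoothSpaceTimeOn.timeDerivWithin_eq_of_subset`),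
`∂ⱼΔ = Δ∂ⱼ` (`partialDeriv_laplacian`), the pressure Hessian is symmetric (`partialDeriv_comm`), and
`∂ⱼ((v·∇)v)ᵢ = ((∂ⱼv)·∇)vᵢ + (v·∇)(∂ⱼv)ᵢ` (`partialDeriv_convect`), whose antisymmetrisation is `(div v)·ω + v·∇ω = v·∇ω`.
Leans on: `TorusFluidGlue` (structure), torus calculus; nothing unproved. [folklore] -/
theorem stub_vorticityEquation :
    ∀ (ν : ℝ) (g : (UnitAddTorus (Fin 2)) → (EuclideanSpace ℝ (Fin 2)))
      (v : ℝ → (UnitAddTorus (Fin 2)) → (EuclideanSpace ℝ (Fin 2))) (p : ℝ → (UnitAddTorus (Fin 2)) → ℝ),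
      Torus.IsSmooth g → Torus.IsClassicalNSSolutionOn (Ici 0) ν (fun _ => g) v p →
      Torus.IsClassicalScalarTransportForcedOn (Ici 0) ν v
        (fun _ x => Torus.partialDeriv 0 g x 1 - Torus.partialDeriv 1 g x 0)
        (fun t x => Torus.partialDeriv 0 (v t) x 1 - Torus.partialDeriv 1 (v t) x 0) :=
  Summit.AnomalousDissipation.AnomalousDissipation.Theorems.TwohalfdThesis.stub_vorticityEquation

/-- **Q2 `stub_envelopedSourceVariance` (M/L; wave) — LANDED p144767 (`Theorems/TwoAndHalfDTwohalfdThesisStubEnvelopedSourceVariance.lean`) — DUHAMEL WITH DATUM: enveloped releases of a steady source cap the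
`limsup`-mean variance.**  Let `κ > 0`, `G` smooth, `ω` a classical solution of `∂ₜω + u·∇ω = κΔω + G` on `[0, ∞) × T²`
whose slice `ω(s₀)` (`s₀ ≥ 0`) has zero mean, and let the classical releases `ψ s` of `G` at every `s ≥ s₀` obey
`‖ψ s (t)‖² ≤ Λ(t−s)²‖G‖²` (`s₀ ≤ s ≤ t`) with `Λ ≥ 0`, `∫₀^∞ Λ ≤ M`.  Then `⟨‖ω‖²⟩ ≤ M²‖G‖²` (honest `limsup` running mean).
PROOF ROUTE: release the datum, `R` := classical solution of the unforced equation on `Ici s₀` with `R s₀ = ω s₀`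
(`stub_globalRelease`); `θ := ω − R` solves the sourced equation on `Ici s₀` with `θ s₀ = 0` (linearity, cf.
`IsClassicalScalarTransportForcedOn.sub`; restriction `Ici 0 → Ici s₀` by `IsSmoothSpaceTimeOn.timeDerivWithin_eq_of_subset`);
shift by `s₀` (`isClassicalScalarTransport(Forced)On_comp_add_const`) and apply D0 `stub_weakDuhamel` + D1
`stub_duhamelVariance` (with its `s₀ := 0`): `‖θ(t)‖² ≤ M²‖G‖²` for `t ≥ s₀`; the transient dies,
`‖R(t)‖² ≤ e^{−8π²κ(t−s₀)}‖ω(s₀)‖²` (`stub_fixedViscosityEnvelope`); so for every `η > 0`,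
`‖ω(t)‖² ≤ (1+η)M²‖G‖² + (1+η⁻¹)e^{−8π²κ(t−s₀)}‖ω(s₀)‖²` on `[s₀, ∞)` (and `‖ω(t)‖²` is continuous, hence bounded, on
`[0, s₀]`), whence the running means are eventually `≤ (1+η)M²‖G‖² + η` (`longTimeAvgSup_le_of_eventually_le`), `η ↓ 0`.
Leans on: D0, D1, `stub_globalRelease`, `stub_fixedViscosityEnvelope`, `LongTimeAverage*`; nothing unproved. [folklore] -/
theorem stub_envelopedSourceVariance :
    ∀ (κ s₀ M : ℝ) (u : ℝ → (UnitAddTorus (Fin 2)) → (EuclideanSpace ℝ (Fin 2))) (G : (UnitAddTorus (Fin 2)) → ℝ)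
      (ω : ℝ → (UnitAddTorus (Fin 2)) → ℝ) (ψ : ℝ → ℝ → (UnitAddTorus (Fin 2)) → ℝ) (Λ : ℝ → ℝ),
      0 < κ → Torus.IsSmooth G → 0 ≤ s₀ →
      Torus.IsClassicalScalarTransportForcedOn (Ici 0) κ u (fun _ => G) ω →
      Torus.HasZeroMean (ω s₀) →
      (∀ s, s₀ ≤ s → Torus.IsClassicalScalarTransportOn (Ici s) κ u (ψ s) ∧ ψ s s = G) →
      (∀ τ, 0 ≤ Λ τ) → IntegrableOn Λ (Ici 0) → (∫ τ in Ici 0, Λ τ) ≤ M →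
      (∀ s t, s₀ ≤ s → s ≤ t → Torus.scalarL2Sq (ψ s t) ≤ Λ (t - s) ^ 2 * Torus.scalarL2Sq G) →
      longTimeAvgSup (fun t => Torus.scalarL2Sq (ω t)) ≤ M ^ 2 * Torus.scalarL2Sq G :=
  Summit.AnomalousDissipation.AnomalousDissipation.Theorems.TwohalfdThesis.stub_envelopedSourceVariance

/-- **Q3 `stub_planarCurlTools` (S/M; wave) — LANDED p145693 (`Theorems/TwoAndHalfDTwohalfdThesisStubPlanarCurlTools.lean`) — planar curl: zero mean and the enstrophy identity.**  For a smooth planar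
field `w` on `T²`: (i) `∫ (∂₀w₁ − ∂₁w₀) = 0` (`hasZeroMean_partialDeriv`); (ii) if moreover `div w = 0`, then
`‖∇w‖₂² = ‖∂₀w₁ − ∂₁w₀‖₂²`, stated with the crux's spectral `Torus.eGradNormSq` (`toReal`): expand both squares, integrate
by parts twice in the cross term `∫ ∂₀w₁ ∂₁w₀ = ∫ ∂₁w₁ ∂₀w₀` (`integral_partialDeriv_mul_eq_neg_integral`,
`partialDeriv_comm`), so that `‖curl w‖² + ‖div w‖² = ∫ Σᵢⱼ (∂ᵢwⱼ)² = gradNormSq w`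
(`gradNormSq_eq_toReal_eGradNormSq_holds`, `partialDeriv_apply_coord`).  Leans on: torus calculus; nothing unproved. [folklore] -/
theorem stub_planarCurlTools :
    (∀ w : (UnitAddTorus (Fin 2)) → (EuclideanSpace ℝ (Fin 2)), Torus.IsSmooth w →
        Torus.HasZeroMean (fun x => Torus.partialDeriv 0 w x 1 - Torus.partialDeriv 1 w x 0)) ∧
    (∀ w : (UnitAddTorus (Fin 2)) → (EuclideanSpace ℝ (Fin 2)), Torus.IsSmooth w → Torus.IsDivFree w →
        (Torus.eGradNormSq w).toReal =
          Torus.scalarL2Sq (fun x => Torus.partialDeriv 0 w x 1 - Torus.partialDeriv 1 w x 0)) :=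
  Summit.AnomalousDissipation.AnomalousDissipation.Theorems.TwohalfdThesis.stub_planarCurlTools

/-- **Q4 `stub_twinEnstrophyCeiling` (S; the lead's assembly of Q1–Q3) — LANDED p146323 (`Theorems/TwoAndHalfDTwohalfdThesisStubTwinEnstrophyCeiling.lean`) — a uniform envelope for the torque pattern caps
the mean enstrophy.**  For a classical solution `(v, p)` of the planar Navier–Stokes system on `[0, ∞) × T²` with steady
smooth force `g` and `ν > 0`, if the classical releases `ψ s` of `curl g` from every `s ≥ s₀ ≥ 0` obey
`‖ψ s (t)‖² ≤ Λ(t−s)²‖curl g‖²` with `Λ ≥ 0`, `∫₀^∞ Λ ≤ M`, then the honest `limsup` mean enstrophy satisfies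
`⟨‖∇v‖₂²⟩ ≤ M²‖curl g‖₂²`.  PROOF ROUTE: Q1 (the vorticity is the sourced scalar), Q3(i) (its slices have zero mean),
Q2 (variance ceiling), Q3(ii) (enstrophy = ‖curl‖² on the smooth divergence-free slices `t ≥ 0`; the running means only
see `t > 0`).  Leans on: Q1, Q2, Q3; nothing unproved. [folklore] -/
theorem stub_twinEnstrophyCeiling :
    ∀ (ν s₀ M : ℝ) (g : (UnitAddTorus (Fin 2)) → (EuclideanSpace ℝ (Fin 2)))
      (v : ℝ → (UnitAddTorus (Fin 2)) → (EuclideanSpace ℝ (Fin 2))) (p : ℝ → (UnitAddTorus (Fin 2)) → ℝ)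
      (ψ : ℝ → ℝ → (UnitAddTorus (Fin 2)) → ℝ) (Λ : ℝ → ℝ),
      0 < ν → Torus.IsSmooth g → Torus.IsClassicalNSSolutionOn (Ici 0) ν (fun _ => g) v p → 0 ≤ s₀ →
      (∀ s, s₀ ≤ s → Torus.IsClassicalScalarTransportOn (Ici s) ν v (ψ s) ∧
          ψ s s = fun x => Torus.partialDeriv 0 g x 1 - Torus.partialDeriv 1 g x 0) →
      (∀ τ, 0 ≤ Λ τ) → IntegrableOn Λ (Ici 0) → (∫ τ in Ici 0, Λ τ) ≤ M →
      (∀ s t, s₀ ≤ s → s ≤ t → Torus.scalarL2Sq (ψ s t) ≤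
          Λ (t - s) ^ 2 * Torus.scalarL2Sq (fun x => Torus.partialDeriv 0 g x 1 - Torus.partialDeriv 1 g x 0)) →
      longTimeAvgSup (fun t => (Torus.eGradNormSq (v t)).toReal) ≤
        M ^ 2 * Torus.scalarL2Sq (fun x => Torus.partialDeriv 0 g x 1 - Torus.partialDeriv 1 g x 0) :=
  Summit.AnomalousDissipation.AnomalousDissipation.Theorems.TwohalfdThesis.stub_twinEnstrophyCeiling

/-- **Q5 `stub_nonselectiveNoGo` (M; the lead's) — LANDED p146373 (`Theorems/TwoAndHalfDTwohalfdThesisStubNonselectiveNoGo.lean`, with corollaries `releasedFamily_torqueMemory`, `releasedMixingWitness_false_of_coscalar`) — THE NON-SELECTIVE NO-GO: a W-witness cannot relax its own torque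
pattern.**  The body of the line's open witness W `stub_releasedMixingWitness` (classical planar Navier–Stokes family with
ONE steady force `g`, pointwise energy `≤ E`, classical releases of `h` with a `j`-uniform integrable envelope after the
spin-up time, Green–Kubo floor `ε > 0`) is contradictory as soon as the releases of the torque pattern `curl g` over the
same flows carry a `j`-uniform integrable envelope of their own (from any spin-up time `s₁ ≥ 0`).  PROOF ROUTE (template
G4 `stub_shellNoGo`): the floor forces `h ≠ 0`; an integrable envelope has a lossy lag (`Λ(τ₀) ≤ 1/2`); the strain gate
(`releasedFamily_meanStrain_ge`) gives mean strain `≥ ((3/4)‖h‖² log(1/ν_j)/C − 1)/τ₀ → ∞`, while Q4 and Jensen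
(`longTimeAvgSup_sqrt_le_sqrt_add_one`) cap it by `√(M'²‖curl g‖² + 1)` uniformly in `j`.  Corollaries (same file):
`h ∈ ℝ·curl g` is impossible for a W-witness (the `h`-envelope is then a torque envelope), and the `L¹`-mass of ANY
torque envelope of the `j`-th member is `≳ log(1/ν_j)` (torque memory).  Leans on: Q4, G1-W/G2 (landed), nothing unproved. [folklore] -/
theorem stub_nonselectiveNoGo :
    ∀ (g : (UnitAddTorus (Fin 2)) → (EuclideanSpace ℝ (Fin 2))) (h : (UnitAddTorus (Fin 2)) → ℝ),
      Torus.IsSmooth g → Torus.IsDivFree g → Torus.HasZeroMean g → Torus.IsSmooth h → Torus.HasZeroMean h →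
      ∀ (ν : ℕ → ℝ) (v : ℕ → ℝ → (UnitAddTorus (Fin 2)) → (EuclideanSpace ℝ (Fin 2))) (p : ℕ → ℝ → (UnitAddTorus (Fin 2)) → ℝ) (φ : ℕ → ℝ → ℝ → (UnitAddTorus (Fin 2)) → ℝ)
        (Λ : ℝ → ℝ) (E s₀ M ε : ℝ),
        (∀ j, 0 < ν j) → Tendsto ν atTop (𝓝 0) →
        (∀ j, Torus.IsClassicalNSSolutionOn (Ici 0) (ν j) (fun _ => g) (v j) (p j)) →
        (∀ j t, 0 ≤ t → ∫ x, ‖v j t x‖ ^ 2 ≤ E) →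
        (∀ j s, 0 ≤ s → Torus.IsClassicalScalarTransportOn (Ici s) (ν j) (v j) (φ j s) ∧ φ j s s = h) →
        0 ≤ s₀ → (∀ τ, 0 ≤ Λ τ) → IntegrableOn Λ (Ici 0) → (∫ τ in Ici 0, Λ τ) ≤ M →
        (∀ j s t, s₀ ≤ s → s ≤ t → Torus.scalarL2Sq (φ j s t) ≤ Λ (t - s) ^ 2 * Torus.scalarL2Sq h) →
        0 < ε →
        (∀ j, ε ≤ liminf (timeMean fun t => ∫ s in (0 : ℝ)..t, ∫ x, h x * φ j s t x) atTop) →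
        ∀ (ψ : ℕ → ℝ → ℝ → (UnitAddTorus (Fin 2)) → ℝ) (Λ' : ℝ → ℝ) (s₁ M' : ℝ),
          0 ≤ s₁ →
          (∀ j s, s₁ ≤ s → Torus.IsClassicalScalarTransportOn (Ici s) (ν j) (v j) (ψ j s) ∧
              ψ j s s = fun x => Torus.partialDeriv 0 g x 1 - Torus.partialDeriv 1 g x 0) →
          (∀ τ, 0 ≤ Λ' τ) → IntegrableOn Λ' (Ici 0) → (∫ τ in Ici 0, Λ' τ) ≤ M' →
          (∀ j s t, s₁ ≤ s → s ≤ t → Torus.scalarL2Sq (ψ j s t) ≤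
              Λ' (t - s) ^ 2 * Torus.scalarL2Sq (fun x => Torus.partialDeriv 0 g x 1 - Torus.partialDeriv 1 g x 0)) →
          False :=
  Summit.AnomalousDissipation.AnomalousDissipation.Theorems.TwohalfdThesis.stub_nonselectiveNoGo


/-- **Q6 `stub_torqueColdStartDiverges` (M; the lead's) — LANDED p147103 (`Theorems/TwoAndHalfDTwohalfdThesisStubTorqueColdStartDiverges.lean`; wired v21, lead c10) — THE Pr = 1 SPLITTING: the torque cold start diverges.**  Along a
family as in W (one steady force `g`, classical planar Navier–Stokes members, classical releases of `h` from every `s ≥ 0` with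
a uniform integrable envelope after `s₀`, Green–Kubo floor `ε > 0`; neither the energy ceiling nor `ν_j → 0` is needed for
the statement), consider over each member the COLD START of the torque pattern, i.e. any classical solution `θ` of
`∂ₜθ + v_j·∇θ = ν_jΔθ + curl g` on `[0, ∞)` with `θ(0) = 0` — the twin of the line's cold start of `h`, whose variance
stays `≤ (s₀+M)²‖h‖²` (D1).  Then there are `κ₀ > 0`, `a > 0`, `b` such that for every member with `ν_j ≤ κ₀` and
`a·log(1/ν_j) ≥ b`: `⟨‖θ‖²⟩ ≥ (a·log(1/ν_j) − b)²` (honest `limsup` mean).  So at Prandtl number one, over the SAME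
witness flow, the `h`-scalar saturates while the torque scalar's mean variance diverges like `log²(1/ν_j)`.  PROOF ROUTE:
G5 `stub_witnessEnstrophyFloor` (mean enstrophy `≥ ((δ‖h‖² log/C − 1)/τ₀)²` after the lossy lag of the `h`-envelope and
`h ≠ 0` from the floor) and the one-flow comparison `⟨‖∇v‖₂²⟩ ≤ ⟨‖θ‖²⟩`: the vorticity `ω` (Q1) minus the cold start
is the unforced release of `ω(0)` (mean zero, Q3 (i)), which dies at fixed `ν` (`stub_fixedViscosityEnvelope`), and
`‖∇v‖₂² = ‖ω‖₂²` (Q3 (ii)); Cesàro bookkeeping with `longTimeAvgSup_le_add_of_le_add`.  Leans on: Q1, Q3, G5, D-tools;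
nothing unproved. [folklore] -/
theorem stub_torqueColdStartDiverges :
    ∀ (g : (UnitAddTorus (Fin 2)) → (EuclideanSpace ℝ (Fin 2))) (h : (UnitAddTorus (Fin 2)) → ℝ),
      Torus.IsSmooth g → Torus.HasZeroMean g → Torus.IsSmooth h →
      ∀ (ν : ℕ → ℝ) (v : ℕ → ℝ → (UnitAddTorus (Fin 2)) → (EuclideanSpace ℝ (Fin 2))) (p : ℕ → ℝ → (UnitAddTorus (Fin 2)) → ℝ)
        (φ : ℕ → ℝ → ℝ → (UnitAddTorus (Fin 2)) → ℝ) (Λ : ℝ → ℝ) (s₀ ε : ℝ),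
        (∀ j, 0 < ν j) →
        (∀ j, Torus.IsClassicalNSSolutionOn (Ici 0) (ν j) (fun _ => g) (v j) (p j)) →
        (∀ j s, 0 ≤ s → Torus.IsClassicalScalarTransportOn (Ici s) (ν j) (v j) (φ j s) ∧ φ j s s = h) →
        0 ≤ s₀ → (∀ τ, 0 ≤ Λ τ) → IntegrableOn Λ (Ici 0) →
        (∀ j s t, s₀ ≤ s → s ≤ t → Torus.scalarL2Sq (φ j s t) ≤ Λ (t - s) ^ 2 * Torus.scalarL2Sq h) →
        0 < ε →
        (∀ j, ε ≤ liminf (timeMean fun t => ∫ s in (0 : ℝ)..t, ∫ x, h x * φ j s t x) atTop) →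
        ∃ κ₀ a b : ℝ, 0 < κ₀ ∧ 0 < a ∧ ∀ j, ν j ≤ κ₀ → 0 ≤ a * Real.log (ν j)⁻¹ - b →
          ∀ θ : ℝ → (UnitAddTorus (Fin 2)) → ℝ,
            Torus.IsClassicalScalarTransportForcedOn (Ici 0) (ν j) (v j)
              (fun _ x => Torus.partialDeriv 0 g x 1 - Torus.partialDeriv 1 g x 0) θ →
            θ 0 = (fun _ => (0 : ℝ)) →
            (a * Real.log (ν j)⁻¹ - b) ^ 2 ≤ longTimeAvgSup (fun t => Torus.scalarL2Sq (θ t)) :=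
  Summit.AnomalousDissipation.AnomalousDissipation.Theorems.TwohalfdThesis.stub_torqueColdStartDiverges

/-! ## R — KERNEL HYGIENE AND TWO MORE GATES (lead c10, 2026-08-17)

Registered tool stubs of lead c10 — ALL LANDED (R1 p165328, R2 p165651, R3 p166491, R4 p166426) and wired below.  (R1) The OBUKHOV–CORRSIN GATE for released families: the
catalogued barrier `Literature.Barriers.AnomalousDissipation.DrivasElgindiIyerJeong2022_thm4` (PROVED in tree,
`DrivasElgindiIyerJeong2022_thm4_holds`: no window anomaly for an unforced scalar released from `C^β` data into an
`L¹_t C^α_x` drift when `α + 2β > 1`) read on the late windows of a W-family — W's envelope at one lossy lag IS a window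
anomaly for the unforced release of the fixed smooth datum `h`, so along `ν_j → 0` the drifts cannot stay uniformly
`L¹(s, s+τ₀; C^α)` while the released patterns stay uniformly `C^β`, `β > (1-α)/2`: a W-witness with tame (Hölder, `α < 1`)
drifts must develop Batchelor-range roughness in its released scalars (the strain gate G speaks only of `‖∇v_j‖_{L²}`,
which may blow up while `C^α`, `α < 1`, stays bounded).  (R2)+(R3) KERNEL HYGIENE: the Green–Kubo clause of W may be read
with `limsup` instead of `liminf` — D2 holds with a `limsup` power floor (R2), so the weaker kernel W' (W with `limsup`-GK)
still gives the crux by name (R3); with H2 (`stub_gkLimsupNecessary`) the `limsup`-GK clause is then EQUIVALENT, over any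
enveloped family, to the dissipation floor of the `h`-cold start: the kernel is "uniform integrable envelope (⇒ bounded
variance, D1) ∧ the cold start of `h` dissipates `≥ ε`", nothing more.  (R4) NO QUIET WINDOWS: a release losing the fraction
`δ` of `‖h‖²` by lag `τ₀` forces kinetic action `∫_s^{s+τ₀} ‖v(t)‖_{L²} dt ≥ ‖h‖(1-√(1-δ))/‖∇h‖_∞ − κτ₀‖Δh‖/‖∇h‖_∞` on that
window (coherence with time-resolved energy): W-witness flows stir persistently, window by window, uniformly in `j`. -/

/-- **R1 `stub_ocGate` (M; wave) — LANDED p165328 (`Theorems/TwoAndHalfDTwohalfdThesisStubOcGate.lean`) — THE OBUKHOV–CORRSIN GATE for released families.**  Classical releases `φ j s` of one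
smooth `h` (`‖h‖₂ > 0`) into the drifts `v j` from every `s ≥ 0`, losing the fraction `δ > 0` of `‖h‖²` by age `τ₀ > 0`
from every release time `s ≥ s₀` (W's envelope at ONE lossy lag), `ν_j → 0`.  Fix Hölder exponents `α, β ∈ (0,1]` ABOVE
the Obukhov–Corrsin line, `α + 2β > 1`, and budgets `K, M` (`‖h‖_{C^{0,β}} ≤ M`).  Then for all large `j` and every
`s ≥ s₀`: if the shifted drift `t ↦ v j (s+t)` lies in `L¹(0,τ₀; C^{0,α})` with norm `≤ K`, the shifted release
`t ↦ φ j s (s+t)` is NOT bounded by `M` in `C^{0,β}` for a.e. `t ∈ (0,τ₀)`.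
PROOF ROUTE: `DrivasElgindiIyerJeong2022_thm4_holds (Fin 2) τ₀ … α β … K M 1` gives `C` with
`eScalarDissipation κ θ 0 τ₀ ≤ ofReal (C κ^{(α+2β-1)/(α+1)})` for every admissible (drift, datum, weak solution with the
energy inequality, `C^β`-bound); the shifted release is classical on `Icc 0 τ₀`
(`isClassicalScalarTransportOn_comp_add_const` + restriction), hence weak with datum `h`
(`IsClassicalScalarTransportOn.isWeakScalarTransportOn_holds`) and satisfies the energy EQUALITY
`‖φ(t)‖² + 2·eScalarDissipation = ‖h‖²` (`scalarL2Sq_add_scalarDissipation_holds`, `eScalarDissipation_eq_ofReal`), so the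
inequality clause holds; the loss gives `2·eScalarDissipation κ_j … 0 τ₀ ≥ δ‖h‖²`, while `C κ_j^{p} → 0`
(`tendsto_rpow…`, exponent `p > 0`) and `κ_j ≤ 1` eventually — contradiction for large `j`.  Leans on: the landed barrier
file `Literature/Barriers/AnomalousDissipation/ObukhovCorrsinThreshold(Proofs)`, `PassiveScalarClassicalWeak`,
`PassiveScalarClassicalEnergy`; nothing unproved. [cite: DrivasEtAl2022, Thm. 4] -/
theorem stub_ocGate :
    ∀ (ν : ℕ → ℝ) (v : ℕ → ℝ → (UnitAddTorus (Fin 2)) → (EuclideanSpace ℝ (Fin 2))) (h : (UnitAddTorus (Fin 2)) → ℝ)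
      (φ : ℕ → ℝ → ℝ → (UnitAddTorus (Fin 2)) → ℝ) (s₀ τ₀ δ : ℝ) (α β K M : ℝ≥0),
      (∀ j, 0 < ν j) → Tendsto ν atTop (𝓝 0) → Torus.IsSmooth h → 0 < Torus.scalarL2Sq h → 0 < τ₀ → 0 < δ →
      (∀ j s, 0 ≤ s → Torus.IsClassicalScalarTransportOn (Ici s) (ν j) (v j) (φ j s) ∧ φ j s s = h) →
      0 ≤ s₀ →
      (∀ j s, s₀ ≤ s → Torus.scalarL2Sq (φ j s (s + τ₀)) ≤ (1 - δ) * Torus.scalarL2Sq h) →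
      0 < α → α ≤ 1 → 0 < β → β ≤ 1 → 1 < (α : ℝ) + 2 * β →
      eBoundedHolderNorm β h ≤ M →
      ∀ᶠ j in atTop, ∀ s, s₀ ≤ s →
        MemLpHolder 1 α (fun t => v j (s + t)) (Ioo 0 τ₀) →
        eLpHolderNorm 1 α (fun t => v j (s + t)) (Ioo 0 τ₀) ≤ K →
        ¬ (∀ᵐ t ∂(volume.restrict (Ioo 0 τ₀)), eBoundedHolderNorm β (φ j s (s + t)) ≤ M) :=
  Summit.AnomalousDissipation.AnomalousDissipation.Theorems.TwohalfdThesis.stub_ocGate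

/-- **R2 `stub_dissipationFloorLimsup` (S; wave) — LANDED p165651 (`Theorems/TwoAndHalfDTwohalfdThesisStubDissipationFloorLimsup.lean`) — D2 with a `limsup` power floor.**  For a classical solution `θ` of
`∂ₜθ + u·∇θ = κΔθ + h` on `[0, ∞) × T²` (`κ ≥ 0`, `h` smooth) with `‖θ(t)‖²_{L²} ≤ B` for `t ≥ 0` and a LIMSUP-mean
input-power floor `ε ≤ limsup_T T⁻¹∫₀ᵀ (h, θ(t)) dt`, the limsup-mean dissipation is `≥ ε`.
PROOF ROUTE: D2's Cesàro identity `dissipationFloor_timeMean_eq` (p89988):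
`T⁻¹∫₀ᵀ κ‖∇θ‖² = T⁻¹∫₀ᵀ(h,θ) − (‖θ(T)‖² − ‖θ(0)‖²)/(2T) ≥ T⁻¹∫₀ᵀ(h,θ) − B/(2T)` and `≤ ‖h‖√B + B/(2T)`; real-variable
bookkeeping: for `δ > 0`, FREQUENTLY `T⁻¹∫₀ᵀ(h,θ) > ε − δ/2` (`Filter.frequently_lt_of_lt_limsup`, the power means are
bounded by `‖h‖√B`) and eventually `B/(2T) < δ/2`, so frequently the dissipation mean is `≥ ε − δ`, whence
`ε − δ ≤ limsup` (`Filter.le_limsup_of_frequently_le`, bounded above).  Leans on: D2's file; nothing unproved. [folklore] -/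
theorem stub_dissipationFloorLimsup :
    ∀ (κ B ε : ℝ) (u : ℝ → (UnitAddTorus (Fin 2)) → (EuclideanSpace ℝ (Fin 2))) (h : (UnitAddTorus (Fin 2)) → ℝ)
      (θ : ℝ → (UnitAddTorus (Fin 2)) → ℝ),
      0 ≤ κ → Torus.IsSmooth h →
      Torus.IsClassicalScalarTransportForcedOn (Ici 0) κ u (fun _ => h) θ →
      (∀ t, 0 ≤ t → Torus.scalarL2Sq (θ t) ≤ B) →
      ε ≤ limsup (timeMean fun t => ∫ x, h x * θ t x) atTop →
      ε ≤ longTimeAvgSup (fun t => κ * (Torus.eScalarGradNormSq (θ t)).toReal) :=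
  Summit.AnomalousDissipation.AnomalousDissipation.Theorems.TwohalfdThesis.stub_dissipationFloorLimsup

/-- **R3 `stub_limsupKernelTransfer` (S/M; the lead's) — LANDED p166491 (`Theorems/TwoAndHalfDTwohalfdThesisStubLimsupKernelTransfer.lean`,
with the corollary `gkLimsup_iff_dissipationFloor`) — the WEAKER KERNEL W' (Green–Kubo clause in `limsup` form) still gives the crux by name.**  `(body of W with `liminf` replaced by `limsup` in the last clause) → TwohalfdThesis`.
PROOF ROUTE: the composition `TwohalfdThesis_of` of the Line file verbatim (cold starts from `exists_global_coldStart`,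
D0 p87403, D1 p88959, T1 p86256, T2 p90523), with the `limsup`-GK clause turned into a `limsup` power floor through D0
(`χ = h`, `Filter.limsup_congr`) and R2 in place of D2.  With H2 `stub_gkLimsupNecessary` the `limsup`-GK clause of W' is
NECESSARY for the cold start's dissipation floor, so W' = (enveloped family) ∧ (the `h`-cold start dissipates `≥ ε`).
Leans on: R2, D0, D1, T1, T2 (landed); nothing unproved. [folklore] -/
theorem stub_limsupKernelTransfer :
    (∃ (g : (UnitAddTorus (Fin 2)) → (EuclideanSpace ℝ (Fin 2))) (h : (UnitAddTorus (Fin 2)) → ℝ),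
      Torus.IsSmooth g ∧ Torus.IsDivFree g ∧ Torus.HasZeroMean g ∧ Torus.IsSmooth h ∧ Torus.HasZeroMean h ∧
      ∃ (ν : ℕ → ℝ) (v : ℕ → ℝ → (UnitAddTorus (Fin 2)) → (EuclideanSpace ℝ (Fin 2))) (p : ℕ → ℝ → (UnitAddTorus (Fin 2)) → ℝ) (φ : ℕ → ℝ → ℝ → (UnitAddTorus (Fin 2)) → ℝ)
        (Λ : ℝ → ℝ) (E s₀ M ε : ℝ),
        (∀ j, 0 < ν j) ∧ Tendsto ν atTop (𝓝 0) ∧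
        (∀ j, Torus.IsClassicalNSSolutionOn (Ici 0) (ν j) (fun _ => g) (v j) (p j)) ∧
        (∀ j t, 0 ≤ t → ∫ x, ‖v j t x‖ ^ 2 ≤ E) ∧
        (∀ j s, 0 ≤ s → Torus.IsClassicalScalarTransportOn (Ici s) (ν j) (v j) (φ j s) ∧ φ j s s = h) ∧
        0 ≤ s₀ ∧ (∀ τ, 0 ≤ Λ τ) ∧ IntegrableOn Λ (Ici 0) ∧ (∫ τ in Ici 0, Λ τ) ≤ M ∧
        (∀ j s t, s₀ ≤ s → s ≤ t → Torus.scalarL2Sq (φ j s t) ≤ Λ (t - s) ^ 2 * Torus.scalarL2Sq h) ∧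
        0 < ε ∧
        (∀ j, ε ≤ limsup (timeMean fun t => ∫ s in (0 : ℝ)..t, ∫ x, h x * φ j s t x) atTop)) →
    TwohalfdThesis :=
  Summit.AnomalousDissipation.AnomalousDissipation.Theorems.TwohalfdThesis.stub_limsupKernelTransfer

/-- **R4 `stub_noQuietWindow` (S/M; wave) — LANDED p166426 (`Theorems/TwoAndHalfDTwohalfdThesisStubNoQuietWindow.lean`) — NO QUIET WINDOWS: a lossy release costs kinetic action on its window.**
For a classical solution `φ` of `∂ₜφ + u·∇φ = κΔφ` (`κ ≥ 0`) on `[s, s+τ₀] × T²` released from the smooth pattern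
`φ(s) = h` and losing the fraction `δ` of `‖h‖²` by age `τ₀ ≥ 0`:
`‖h‖₂ (1 − √(1−δ)) ≤ ‖∇h‖_∞ ∫_s^{s+τ₀} ‖u(r)‖_{L²} dr + κ τ₀ ‖Δh‖₂` (no sign hypothesis on `δ` is needed).
PROOF ROUTE (coherence with time-resolved energy, cf. F1 `stub_coherenceOfEnergy` p97305): the datum correlation
`D(r) = ∫ h φ(r)` is differentiable within `[s, s+τ₀]` with `D' = ∫ φ ⟪u, ∇h⟫ + κ ∫ φ Δh` (equation, transport identity
`integral_mul_inner_gradient_add_eq_zero`, Green `integral_mul_laplacian_comm_holds`), so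
`|D'(r)| ≤ ‖h‖₂(‖∇h‖_∞‖u(r)‖₂ + κ‖Δh‖₂)` (Cauchy–Schwarz and the `L²` decay `‖φ(r)‖ ≤ ‖h‖`,
`antitoneOn_scalarL2Sq`); integrate (FTC for the continuous derivative): `D(s+τ₀) ≥ ‖h‖² − ‖h‖₂ R`; on the other hand
`D(s+τ₀) ≤ ‖h‖₂‖φ(s+τ₀)‖₂ ≤ ‖h‖₂ √(1−δ) ‖h‖₂`; divide by `‖h‖₂` (the case `‖h‖₂ = 0` is trivial).  Leans on:
`PassiveScalarClassicalEnergy`, `PassiveScalarClassicalWeak`, F1's file; nothing unproved. [folklore] -/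
theorem stub_noQuietWindow :
    ∀ (κ s τ₀ δ : ℝ) (u : ℝ → (UnitAddTorus (Fin 2)) → (EuclideanSpace ℝ (Fin 2))) (h : (UnitAddTorus (Fin 2)) → ℝ)
      (φ : ℝ → (UnitAddTorus (Fin 2)) → ℝ),
      0 ≤ κ → Torus.IsSmooth h → 0 ≤ τ₀ →
      Torus.IsClassicalScalarTransportOn (Icc s (s + τ₀)) κ u φ → φ s = h →
      Torus.scalarL2Sq (φ (s + τ₀)) ≤ (1 - δ) * Torus.scalarL2Sq h →
      Real.sqrt (Torus.scalarL2Sq h) * (1 - Real.sqrt (1 - δ)) ≤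
        (⨆ x, ‖Torus.gradient h x‖) * (∫ r in s..(s + τ₀), Real.sqrt (∫ x, ‖u r x‖ ^ 2)) +
          κ * τ₀ * Real.sqrt (Torus.scalarL2Sq (Torus.laplacian h)) :=
  Summit.AnomalousDissipation.AnomalousDissipation.Theorems.TwohalfdThesis.stub_noQuietWindow

/-! ### R5–R6 (lead c10, wave 2; BOTH LANDED, p168786 p169071): the quantitative Obukhov–Corrsin gate and the mean-energy floor of a lossy family -/

/-- **R5 `stub_ocGateQuantitative` (M; wave 2) — LANDED p168786 (`Theorems/TwoAndHalfDTwohalfdThesisStubOcGateQuantitative.lean`) — THE QUANTITATIVE OBUKHOV–CORRSIN GATE: Batchelor-range roughness grows like a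
POWER of `1/ν_j`.**  Same released families as R1 (loss `δ` of `‖h‖²` at lag `τ₀` from every `s ≥ s₀`, `ν_j → 0`), exponents
`α, β ∈ (0,1]` with `α + 2β > 1` and a drift budget `K`.  There is `c = c(K, τ₀) > 0` such that for all large `j`, every
`s ≥ s₀` and every level `M`: if `‖v_j(s+·)‖_{L¹(0,τ₀;C^α)} ≤ K`, `‖h‖_{C^β} ≤ M` and `‖φ_{j,s}(s+t)‖_{C^β} ≤ M` for a.e.
`t ∈ (0,τ₀)`, then `c·δ·‖h‖²·ν_j^{-(α+2β-1)/(α+1)} ≤ M²` — while the strain need only grow like `log(1/ν_j)` (G), the Hölder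
budget of the released scalar over tame drifts must grow polynomially (for `β = 1`, `α ↓ 0`: `‖∇φ‖_∞ ≳ ν^{-1/2}`, the Batchelor
scale).  R1 is the qualitative corollary.
PROOF ROUTE: the fixed-scale bound `DrivasElgindiIyerJeong2022_thm4.two_mul_eScalarDissipation_le` (Barriers/…/ObukhovCorrsinThresholdProofs,
(5.10) before optimisation): for `0 < ε ≤ 1/4`,
`2·eScalarDissipation ≤ ofReal (M²ε^{2β} + 2(2dC₁M²ε^{α+2β-1}K + τ₀κ dC₁²M²ε^{2β-2}))`, `d = 2`, `C₁ = Torus.gradProfileMass (Fin 2)`;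
the shifted release is weak with the energy clause as in R1 (`ocGate_lintegral_sq_add_two_mul_eScalarDissipation_eq`, p165328)
and `2·eScalarDissipation = ‖h‖² − ‖φ(s+τ₀)‖² ≥ δ‖h‖²`; choose `ε = κ^{1/(α+1)}` (admissible once `κ_j ≤ 4^{-(α+1)}`,
eventually): every term is `≤ M² κ^{p}·const`, `p = (α+2β-1)/(α+1)` (`κ^{2β/(α+1)} ≤ κ^p` for `κ ≤ 1` since `α ≤ 1`), so
`δ‖h‖² ≤ M² κ_j^p (1 + 8C₁K + 4C₁²τ₀)`; `c := (1 + 8C₁K + 4C₁²τ₀)⁻¹`.  Leans on: R1's file, the barrier's Proofs file; nothing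
unproved. [cite: DrivasEtAl2022, proof of Thm. 4, (5.9)–(5.10)] -/
theorem stub_ocGateQuantitative :
    ∀ (ν : ℕ → ℝ) (v : ℕ → ℝ → (UnitAddTorus (Fin 2)) → (EuclideanSpace ℝ (Fin 2))) (h : (UnitAddTorus (Fin 2)) → ℝ)
      (φ : ℕ → ℝ → ℝ → (UnitAddTorus (Fin 2)) → ℝ) (s₀ τ₀ δ : ℝ) (α β K : ℝ≥0),
      (∀ j, 0 < ν j) → Tendsto ν atTop (𝓝 0) → Torus.IsSmooth h → 0 < τ₀ →
      (∀ j s, 0 ≤ s → Torus.IsClassicalScalarTransportOn (Ici s) (ν j) (v j) (φ j s) ∧ φ j s s = h) →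
      0 ≤ s₀ →
      (∀ j s, s₀ ≤ s → Torus.scalarL2Sq (φ j s (s + τ₀)) ≤ (1 - δ) * Torus.scalarL2Sq h) →
      0 < α → α ≤ 1 → 0 < β → β ≤ 1 → 1 < (α : ℝ) + 2 * β →
      ∃ c : ℝ, 0 < c ∧ ∀ᶠ j in atTop, ∀ s, s₀ ≤ s → ∀ M : ℝ≥0,
        MemLpHolder 1 α (fun t => v j (s + t)) (Ioo 0 τ₀) →
        eLpHolderNorm 1 α (fun t => v j (s + t)) (Ioo 0 τ₀) ≤ K →
        eBoundedHolderNorm β h ≤ M →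
        (∀ᵐ t ∂(volume.restrict (Ioo 0 τ₀)), eBoundedHolderNorm β (φ j s (s + t)) ≤ M) →
        c * δ * Torus.scalarL2Sq h * (ν j) ^ (-(((α : ℝ) + 2 * β - 1) / ((α : ℝ) + 1))) ≤ (M : ℝ) ^ 2 :=
  Summit.AnomalousDissipation.AnomalousDissipation.Theorems.TwohalfdThesis.stub_ocGateQuantitative

/-- **R6 `stub_meanEnergyFloorOfLoss` (S/M; wave 2) — LANDED p169071 (`Theorems/TwoAndHalfDTwohalfdThesisStubMeanEnergyFloorOfLoss.lean`) — THE MEAN-ENERGY FLOOR OF A LOSSY FAMILY** (R4 + sliding windows).  One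
drift `u` on `[0,∞) × T²` with pointwise energy `∫‖u(t)‖² ≤ E` (`t ≥ 0`; only to make the `limsup` honest), classical releases
`φ s` of the smooth pattern `h` from every `s ≥ 0`, losing the fraction `δ` of `‖h‖²` by age `τ₀ > 0` from every `s ≥ s₀`; put
`A := ‖h‖₂(1 − √(1−δ)) − κτ₀‖Δh‖₂`.  If `A ≥ 0` then the honest `limsup` long-time mean of the kinetic energy obeys
`(A / (‖∇h‖_∞ τ₀))² ≤ ⟨∫‖u‖²⟩`: fast uniform relaxation of ONE pattern (small `τ₀`) costs MEAN kinetic energy `≳ τ₀⁻²`, not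
just sup-energy (`stub_dissipationTimeLowerBound`) — intermittent witnesses with small mean but large peak energy are excluded.
PROOF ROUTE: R4 `stub_noQuietWindow` on `[s, s+τ₀]` (restrict the release from `Ici s`; p166426) and Cauchy–Schwarz in time:
`A ≤ ‖∇h‖_∞ ∫_s^{s+τ₀}‖u‖₂ ≤ ‖∇h‖_∞ √τ₀ (∫_s^{s+τ₀}‖u‖₂²)^{1/2}`, so every late window carries `∫_s^{s+τ₀}∫‖u‖² ≥ A²/(‖∇h‖²_∞ τ₀)`
(if `‖∇h‖_∞ = 0` the claim is `0 ≤ ⟨…⟩`, `longTimeAvgSup_nonneg`); G2 `stub_windowsToMean` (p99815) with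
`φ t := ofReal (∫‖u t‖²)` (continuous in `t`: `u` is jointly smooth on `Ici 0` by the release structure at `s = 0`; locally
finite; running means bounded by `E`) gives `⟨∫‖u‖²⟩ ≥ A²/(‖∇h‖²_∞ τ₀²)`.  Leans on: R4, G2; nothing unproved. [folklore] -/
theorem stub_meanEnergyFloorOfLoss :
    ∀ (κ E s₀ τ₀ δ : ℝ) (u : ℝ → (UnitAddTorus (Fin 2)) → (EuclideanSpace ℝ (Fin 2))) (h : (UnitAddTorus (Fin 2)) → ℝ)
      (φ : ℝ → ℝ → (UnitAddTorus (Fin 2)) → ℝ),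
      0 ≤ κ → Torus.IsSmooth h → 0 < τ₀ → 0 ≤ s₀ →
      (∀ t, 0 ≤ t → ∫ x, ‖u t x‖ ^ 2 ≤ E) →
      (∀ s, 0 ≤ s → Torus.IsClassicalScalarTransportOn (Ici s) κ u (φ s) ∧ φ s s = h) →
      (∀ s, s₀ ≤ s → Torus.scalarL2Sq (φ s (s + τ₀)) ≤ (1 - δ) * Torus.scalarL2Sq h) →
      0 ≤ Real.sqrt (Torus.scalarL2Sq h) * (1 - Real.sqrt (1 - δ)) -
          κ * τ₀ * Real.sqrt (Torus.scalarL2Sq (Torus.laplacian h)) →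
      ((Real.sqrt (Torus.scalarL2Sq h) * (1 - Real.sqrt (1 - δ)) -
            κ * τ₀ * Real.sqrt (Torus.scalarL2Sq (Torus.laplacian h))) /
          ((⨆ x, ‖Torus.gradient h x‖) * τ₀)) ^ 2 ≤
        longTimeAvgSup (fun t => ∫ x, ‖u t x‖ ^ 2) :=
  Summit.AnomalousDissipation.AnomalousDissipation.Theorems.TwohalfdThesis.stub_meanEnergyFloorOfLoss

/-! ## Composition — the crux BY NAME from W, D0, D1, D2, T2 (no sorry of its own) -/

/-- **`TwohalfdThesis_of_stubs` — the line closes the crux BY NAME**, fed with the registered stubs (the audit sees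
`TwohalfdThesis` inhabited modulo the ONE remaining `sorry`, W `stub_releasedMixingWitness`; D0–D2, T1, T2 are the landed
tree theorems).  W gives `(g, h)`, the NS
family, the released families, envelope and floor; the landed `ColdStartVariance.exists_global_coldStart` gives the
classical cold starts `θ_j`; D0 the weak Duhamel identity; D1 the variance bound `(s₀+M)²‖h‖²`; the GK floor rewritten
through D0 (`χ = h`) is a liminf-mean input-power floor, so D2 gives `⟨ν_j‖∇θ_j‖²⟩ ≥ ε`; T1 makes
`u_j = (v_j, θ_j)∘π` a classical 3-D solution forced by `f = (g,h)∘π`, hence a global Leray–Hopf solution from its own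
initial slice (`isLerayHopfOn_of_convex`), `x₃`-invariant (`twoHalf_add_single`), with `f` smooth, solenoidal, mean zero
and `x₃`-invariant; T2 turns the pointwise budgets into `meanEnergy ≤ E + (s₀+M)²‖h‖²` and `meanDissipation ≥ ε`.
(The same composition with the five statements as HYPOTHESES is `Theorems/TwoAndHalfDTwohalfdThesisLine.lean`,
`TwohalfdThesis.TwohalfdThesis_of`, landed `--supports`.) -/
theorem TwohalfdThesis_of_stubs : TwohalfdThesis :=
  Summit.AnomalousDissipation.AnomalousDissipation.Theorems.TwohalfdThesis.TwohalfdThesis_of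
    stub_releasedMixingWitness stub_weakDuhamel stub_duhamelVariance stub_dissipationFloor stub_liftBudget

/-- **`TwohalfdThesis_of_stubs'` — the same crux through the WEAKER kernel W′** (lead c10): W ⇒ W′
(`releasedMixingWitness_imp_limsupKernel`, p166941) ⇒ X (R3 `stub_limsupKernelTransfer`, p166491); the only `sorry` in
its cone is again W. [folklore] -/
theorem TwohalfdThesis_of_stubs' : TwohalfdThesis :=
  stub_limsupKernelTransfer
    (Summit.AnomalousDissipation.AnomalousDissipation.Theorems.TwohalfdThesis.releasedMixingWitness_imp_limsupKernel
      stub_releasedMixingWitness)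

end Summit.AnomalousDissipation.AnomalousDissipation.Cruxes.TwohalfdThesis.DuhamelRelease

end
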